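import Mathlib
import HarnessLib

/-!
# Müller–Schiemann, *Continuum limit of a hierarchical SU(2) lattice gauge theory in 4 dimensions*
# (CMP 110, 1987), Sect. 6 PROPOSITION 2 — the running of the marginal coefficient `β̂` at ALL scales,
# UNIFORMLY IN THE CUTOFF: `β̂_N^{(−n)} = B_n + O(B_n^{−1+2α})` (6.8), with (6.6), (6.7), (6.9)–(6.12) and (v1.1)
# (6.13)–(6.14), PROVED model-free (the decoupled recursion (6.4) is the hypothesis; every constant explicit)

statement-level skeleton of published theorems with citation tags; proofs where landed; nothing here is a claim about the Yang–Mills mass gap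

**Citation header (reproduction of PUBLISHED work).** V. F. Müller, J. Schiemann, *Continuum limit of a hierarchical
SU(2) lattice gauge theory in 4 dimensions*, Commun. Math. Phys. **110** (1987) 261–286, doi 10.1007/BF01207367
[MullerSchiemann1987], Sect. 6 «Ultraviolet Stability and Continuum Limit of Effective Actions», pp. 278–280.
Loci `p.NNN L.nn` are journal page and line of the held Project Euclid scan `paper:url-96df5da18d4c` (PDF page =
journal page − 260); the displays (3.5), (6.2)–(6.12), which the scan's text layer garbles, were read on page renders
(poppler/cairo of PDF pp. 6, 18–20; the renders of pp. 18–20 are also filed by the YM LIT SWEEP fit-ref at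
`inprint/lit-balaban-p18/renders-cmp110ms/`). This file is the Lean lane of the lit-balaban YM LIT SWEEP CONTEXT row
X1 (register level; zero weight for any token of that table): the model is the `d = 4` HIERARCHICAL `SU(2)` gauge model
(Migdal's recursion as an exact renormalization group), NOT lattice Yang–Mills; Proposition 2 is that model's
counterpart of the marginal-coupling flow theorem, and what is kernel-checked here is its real-variable content.

**What the paper prints (verbatim; displays image-read).**
* p.278 L.20–24: *«As a first step we investigate the flow of the coupling coefficients β_N^{(−n)}, λ_N^{(−n)}, σ_N^{(−n)}
  for a given cutoff N, with the initial Gibbs factor g_N^{(−N)} chosen such that Theorem 1, respectively its corollary,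
  apply (at least) N times, i.e. β_N^{(0)} > β̲. Denoting for shortness β_N^{(−n)} by β and β_N^{(−n+1)} by β′, similarly
  λ and λ′, σ and σ′, we recall the recursion relations (3.7), (3.15).»* (so the primed coupling lives one scale
  COARSER; (3.4) p.266: *«β ≥ β̲, β̲ ∈ ℝ₊ sufficiently large»*; (3.5) p.266: *«|z| < β^{−α}, with 3/7 ≤ α < ½ (fixed)»*).
* (6.2) p.278: *«β̂ := β + (5/3)λβ⁻¹ − (5/27)λβ⁻² − (31/9)λ²β⁻³ + (35/9)σβ⁻², λ̂ := λ + 7/270 − (11/3)λ²β⁻² + (14/3)σβ⁻¹,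
  σ̂ := σ»* (r = 2); *«In the case of r = 4 we calculate β̂ = β + 2λβ⁻¹ + O(β⁻¹).»*
* (6.4) p.278: *«β̂′ = β̂ − c₀ − c₋₁β̂⁻¹ + R₁, |R₁| < A₁β̂^{−2+2α}; λ̂′ = r^{−2}λ̂ + R₂, |R₂| < A₂β̂^{−2+4α}; σ̂′ = r^{−4}σ̂ + R₃,
  |R₃| < A₃β̂^{−2+6α}»*; p.279 L.2–4: *«The positive constants A_{1,2,3} do not depend on the iteration step, and the
  parameters c₀, c₋₁ are»* (6.5) *«c₀ = 1/6, c₋₁ = 1/54 for r = 2, c₀ = 1/2, c₋₁ = 1/15 for r = 4.»*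
* p.279 L.7–9: *«From the positivity of c₀, implying that the marginal coefficient β̂ decreases with increasing lattice
  spacing, we recognize UV-asymptotic freedom. The flow of β, as well as that of the contractive couplings λ and σ, is
  controlled by the flow of β̂.»*  (6.6): *«We define for m ∈ ℕ₀ and β₀ ∈ ℝ₊, β₀ > β̲, B_m := β₀ + c₀m +
  (c₋₁/c₀) ln{1 + c₀m/β₀}.»*  (6.7): *«Then one easily calculates with d ∈ ℝ, |d| < S₁ ∈ ℝ₊,
  B_m + d − c₀ − c₋₁/(B_m + d) − B_{m−1} = d + P_{m−1}, |P_{m−1}| < C₁(B_{m−1})^{−2+ε₁}. The positive constant C₁ does not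
  depend on m and is uniform in d, |d| < S₁, and the small positive ε₁ absorbs ln(m) terms.»*
* **Proposition 2** (p.279): *«Choosing for all N ∈ ℕ₀ initial Gibbs factors g_N^{(−N)}(u) satisfying (A₁)–(A₃), with
  initial values β̂_N^{(−N)} = B_N + b_N with B_N from (6.6) and b_N = O(B_N^{−1}), the recursion relations (6.4) imply for
  n ∈ ℕ₀ uniformly in N ≥ n,»* (6.8) *«β̂_N^{(−n)} = B_n + O(B_n^{−1+2α}), λ̂_N^{(−n)} = r^{−2(N−n)}λ̂_N^{(−N)} + O(B_n^{−2+4α}),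
  σ̂_N^{(−n)} = r^{−4(N−n)}σ̂_N^{(−N)} + O(B_n^{−2+6α}).»*
* Proof (p.279 L.22 – p.280 L.8): *«For β̂ = B_m + d, d = O(1), follows from (6.4) due to (6.7), β̂′ = B_{m−1} + d + φ_{m−1},
  with φ_{m−1} ≡ R₁ + P_{m−1}, |φ_{m−1}| < A₁(B_m + d)^{−2+2α} + C₁(B_{m−1})^{−2+ε₁} < (1 + δ₅)A₁(B_{m−1})^{−2+2α}, with a
  constant δ₅ > 0. Repeated iteration, starting with the initial values of the proposition, implies»* (6.9)
  *«β̂_N^{(−n)} = B_n + b_N + Σ_{m=n}^{N−1} φ_m, |φ_m| < (1 + δ₅)A₁B_m^{−2+2α}. It is crucial to observe that the respective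
  values of d occurring in these iterations are uniformly bounded, since the series Σ_{m=0}^∞ φ_m converges absolutely.
  Hence an appropriate bound S₁ entering (6.7) and a constant δ₅ can be chosen on account of a sufficiently large value of
  β₀. Repeated iteration of the recursion relations for λ̂ and σ̂ together with the result obtained for β̂_N^{(−n)}
  yields»* (6.10) *«λ̂_N^{(−n)} = r^{−2(N−n)}λ̂_N^{(−N)} + Σ_{k=n+1}^{N} r^{−2(k−n−1)}ψ_k, |ψ_k| < A₂(1 + δ₆)B_k^{−2+4α}»*,
  (6.11) *«σ̂_N^{(−n)} = r^{−4(N−n)}σ̂_N^{(−N)} + Σ_{k=n+1}^{N} r^{−4(k−n−1)}ω_k, |ω_k| < A₃(1 + δ₇)B_k^{−2+6α}, with suitably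
  chosen constants δ₆, δ₇. It is straightforward to bound the sums in (6.9)–(6.11), e.g. by corresponding integrals,
  and therefrom obtain the estimates stated in the proposition, uniformly in N.»* ∎
* (6.12) p.280: *«… the first terms in (6.8) contributing to λ̂, σ̂ are strongly damped, which we infer from the
  inequality, valid for N ∈ ℕ₀, N > n, B_N < B_n(1 + c₋₁/(c₀β₀))(1 + c₀/β₀)^{N−n}, and 1 + c₀/β₀ being small compared
  to r.»*
* (6.13)–(6.14) p.280: *«From Proposition 2 we deduce a very precise picture of the flow of couplings, exhibiting
  general features of the transformation. Since λ̂_N^{(−N)} and σ̂_N^{(−N)} are restricted to be (at most) O(β_N^{(−N)}) =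
  O(B_N), the first terms in (6.8) contributing to λ̂, σ̂ are strongly damped […(6.12)…]. Thus Proposition 2 implies for
  any scale n ∈ ℕ₀, uniformly in N > n + 2(ln r)⁻¹ ln(β₀ + c₀n),»* (6.13) *«λ̂_N^{(−n)} = O(B_n^{−2+4α}),
  σ̂_N^{(−n)} = O(B_n^{−2+6α}), which entails due to (6.3), in the case of r = 2,»* (6.14) *«λ_N^{(−n)} = λ_* +
  O(B_n^{−2+4α}), λ_* = −7/270, σ_N^{(−n)} = O(B_n^{−2+6α}), β_N^{(−n)} = β̂_N^{(−n)} + O(B_n^{−1}) = B_n + O(B_n^{−1+2α}).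
  For r = 4 (6.14) holds with λ_* = −7/150. Hence the couplings β_N^{(−n)}, λ_N^{(−n)}, σ_N^{(−n)} at scale n are found
  within intervals determined by B_n, uniformly in the cutoff N > n + 2(ln r)⁻¹ ln(β₀ + c₀n) and for arbitrary bare
  actions g_N^{(−N)}(u) [satisfying (A₁)–(A₃)], provided we fix β̂_N^{(−N)} as stated in the proposition.»*

**What is reproduced here (kernel-checked, zero `sorry`, zero named facts, MODEL-FREE).** The Gibbs factors, the
Migdal recursion (3.1) and Theorem 1 are not modelled: a trajectory is an arbitrary real sequence `x k = β̂_N^{(−k)}`,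
`k = N, N−1, …, 0`, and the decoupled recursion (6.4) is the HYPOTHESIS
`β̄ ≤ x (k+1) → |x k − (x (k+1) − c₀ − c₋₁/x (k+1))| ≤ A₁ (x (k+1))^{−2+2α}` (`k < N`).  Constants `c₀ > 0`, `c₋₁ ≥ 0`
(written `c₁` in Lean), `0 < α < ½`, `A₁ ≥ 0` are parameters; (6.5)'s values are instances.
* §0 `consts_r2`, `consts_r4` — the arithmetic linking (6.5) to (3.7), (3.15) and (6.2): `c₋₁` is minus the
  `β⁻¹`-coefficient of `β̂′ − β̂` (e.g. `1/72 − (5/3)(7/360) = −1/54`, `1/48 − 2·(7/160) = −1/15`), `λ̂ − λ = −λ*` with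
  `λ*` the fixed point of the constant-plus-linear part of the `λ`-recursion (ours; a consistency check of the print).
* §1 `B` = (6.6) and its elementary properties: `B_zero`, `lin_le_B` (`β₀ + c₀m ≤ B_m`), `B_le_lin`
  (`B_m ≤ (1 + c₋₁/(c₀β₀))(β₀ + c₀m)`), `B_succ_sub` (the increments), `B_mono`/`B_strictMono`, and **`B_le_geom`** =
  (6.12) in the form `B_N ≤ B_n(1 + c₋₁/(c₀β₀))(1 + c₀/β₀)^{N−n}` for all `n ≤ N`; `B_r2`, `B_r4` (the printed instances).
* §2 **(6.7)**: `P` (indexed by the lower scale: `P m d` is the print's `P_{m}` for `β̂ = B_{m+1} + d`), `eq67` (the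
  identity), `P_eq`, and **`abs_P_le`**: `|P_m(d)| ≤ C₁ B_m^{−2+ε}` for `|d| ≤ S`, `β₀ ≥ max(1, 2S)`, every `0 < ε ≤ 1`, with
  `C₁ = 2c₋₁(1 + c₋₁/c₀)²((c₀ + S) + c₋₁(1 + c₀)/(c₀ε))` — «ε₁ absorbs ln(m) terms» is `ln y ≤ y^ε/ε`.
* §3 the «corresponding integrals»: `rpow_step` (convexity of `t^{p+1}`, `p < −1`, by the mean-value inequality),
  `sum_lin_rpow_le` (`Σ_{m∈[n,M)} (β₀ + c₀m)^p ≤ (1 + 1/((−p−1)c₀))(β₀ + c₀n)^{p+1}`), **`sum_B_rpow_le`**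
  (`Σ_{m∈[n,M)} B_m^p ≤ κ B_n^{p+1}`, `κ = (1 + 1/((−p−1)c₀))(1 + c₋₁/c₀)^{−(p+1)}`, uniformly in `M`).
* §4 **PROPOSITION 2, first line**: `step_bound` (one step of (6.9): `|φ_m| ≤ A′B_m^{−2+2α}`, `A′ = 4A₁ +
  C₁(c₀,c₋₁,1,2α)` — the print's `(1 + δ₅)A₁`), `prop2_core` (downward induction carrying (6.9)'s bound
  `|β̂^{(−n)} − B_n| ≤ |b_N| + A′Σ_{m=n}^{N−1}B_m^{−2+2α}` together with «the values of d are uniformly bounded» (`≤ 1`)),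
  `βstar`/`βstar_spec` (an explicit «sufficiently large β₀»: `β⋆ = max(2, β̄ + 1, 2b, (2A′κ)^{1/(1−2α)})`), and
  **`prop2_marginal`**: for `β₀ ≥ β⋆`, `|β̂^{(−N)} − B_N| ≤ b/B_N` and the recursion hypothesis, EVERY `n ≤ N` has
  `|β̂^{(−n)} − B_n| ≤ K B_n^{−1+2α}` with `K = b + A′κ` independent of `n`, `N`, `β₀`, the trajectory stays within `1`
  of `B` and inside the domain `β̂ ≥ β̄` («Theorem 1 … appl[ies] (at least) N times»); `prop2_marginal_uniform` is the
  `∃ β⋆ K ∀ β₀ ≥ β⋆ ∀ N` packaging («for n ∈ ℕ₀ uniformly in N ≥ n»); `prop2_marginal_r4` the gauge-theory instance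
  `c₀ = 1/2`, `c₋₁ = 1/15`.
* §5 **(6.9)**: `eq69` (the telescoped identity `β̂^{(−n)} − B_n = b_N + Σ_{m=n}^{N−1}φ_m`,
  `φ_m = (β̂^{(−m)} − B_m) − (β̂^{(−m−1)} − B_{m+1})`) and `eq69_bound` (`|φ_m| ≤ A′B_m^{−2+2α}` along the trajectory).
* §6 **PROPOSITION 2, second and third lines** via (6.10)–(6.11): `geom_telescope`
  (`y_n − ρ^J y_{n+J} = Σ_{j<J} ρ^j(y_{n+j} − ρy_{n+j+1})`), **`contractive_decay`** (`|ψ| ≤ AB^q`, `q ≤ 0`, `0 ≤ ρ < 1` ⇒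
  `|y_n − ρ^{N−n}y_N| ≤ (A/(1−ρ))B_n^q` — the `λ̂`-line, `q = −2+4α`), **`contractive_growth`** (`q ≥ 0` with the
  damping condition `ρ(1 + c₀/β₀)^q < 1` — the `σ̂`-line, `q = −2+6α ∈ [4/7, 1)` for the printed `α`, «suitably chosen
  constants δ₇», «1 + c₀/β₀ being small compared to r»), `prop2_contractive` / `prop2_contractive_growth` (the same
  along the trajectory of `prop2_marginal`, the remainders given as printed in powers of `β̂` and converted by
  `rpow_le_four_mul` / `rpow_le_two_mul`), and `damping` ((6.12) applied: `ρ^{N−n}B_N ≤ (1 + c₋₁/(c₀β₀))B_n(ρ(1 + c₀/β₀))^{N−n}`).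
* §7 (v1.1, same seat, append-only) **(6.13)** and the `β`-line of **(6.14)**: `damped_initial` (an initial value
  `|y_N| ≤ C_y B_N` contributes at scale `n` at most `C_y(1 + c₋₁/(c₀β₀))³B_n⁻¹` once `(β₀ + c₀n)² ≤ r^{N−n}` — the
  printed threshold `N > n + 2(ln r)⁻¹ln(β₀ + c₀n)` — and `ρ(1 + c₀/β₀) ≤ r⁻¹` — «1 + c₀/β₀ being small compared to
  r»), **`eq613`** (the `λ̂`-line: `|λ̂^{(−n)}| ≤ C·B_n^{−2+4α}`), **`eq613_sigma`** (the `σ̂`-line: `|σ̂^{(−n)}| ≤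
  C·B_n^{−2+6α}`), both along the trajectory of `prop2_marginal` with `C` explicit and independent of `n`, `N`, and
  `eq614_beta` (`|β^{(−n)} − B_n| ≤ (K + 2C)B_n^{−1+2α}` for any `β` with `|β − β̂| ≤ C/β̂` along the trajectory; the
  two printed values of `λ_*` are the fixed points of `consts_r2` / `consts_r4`).

**Readings (declared).** (i) INDEXING: `x k` is the coupling at lattice spacing `2^{−k}`; one renormalization step maps
`x (k+1) ↦ x k` (p.278 L.22–23), the cutoff is `k = N`, and `P m`, `φ m` carry the LOWER index as in print. (ii) The
weak-coupling condition of Theorem 1 is `β ≥ β̲` on `β`; here the threshold `β̄` is placed on `β̂ = x (k+1)` (the two differ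
by `O(λβ⁻¹)`, (6.2)–(6.3)); it enters only as the guard of the recursion hypothesis and is DISCHARGED along the
trajectory (`prop2_marginal`, third conjunct). (iii) `O(·)`-constants are explicit: `b_N = O(B_N^{−1})` is
`|b_N| ≤ b·B_N^{−1}`; `|R₁| < A₁β̂^{−2+2α}` is assumed with `≤` (weaker); «ε₁ absorbs ln(m) terms» is realised with
`ε₁ = ε` arbitrary in `(0,1]`, used at `ε = 2α`; `S₁ = 1`. (iv) The exponent hypotheses are exactly what the sums need:
`0 < α < ½` (print: `3/7 ≤ α < ½`), so `−2+2α < −1` (absolute convergence of `Σφ_m`), `−2+4α < 0` (decay case),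
`−2+6α ≥ 0` (growth case, damping needed — as the print says). (v) (6.12) is proved with `≤` for all `n ≤ N` (the
print's strict `<` for `N > n` needs `c₋₁ > 0`; not used).

**What is NOT claimed.** Theorem 1 / its Corollary (that the Migdal recursion (3.1) reproduces (A₁)–(A₃) and yields
(3.7), (3.15), hence (6.4)) — the recursion is a hypothesis here; the inversion (6.3) of (6.2); the first step
`β = β̂ + O(B_n^{−1})` of (6.14) (it is (6.3) with bounded `λ`, `σ` — a hypothesis of `eq614_beta`) and the `λ`-, `σ`-lines
of (6.14) beyond their `λ̂`-, `σ̂`-form (6.13); in (6.13) the restriction of the initial values to `O(B_N)` and the cutoff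
threshold are hypotheses (`|y_N| ≤ C_y B_N`, `(β₀ + c₀n)² ≤ r^{N−n}`), not consequences of a construction; Theorems 2–4
(Gibbs-factor bounds, normal families, subsequential continuum limit); anything about lattice Yang–Mills, Bałaban's
papers, a β-function of YM₄ or the Clay problem.
-/

noncomputable section

open Real Finset

namespace Literature.MathematicalPhysics.QuantumFieldTheory.MullerSchiemann1987.CouplingFlow

/-! ### §0. The printed constants (6.5) from (3.7), (3.15), (6.2) -/

/-- r = 2: the fixed point of the constant and linear part of the `λ`-recursion of (3.7),
`λ' = ¼λ − 7/360`, is `λ* = −7/270` (so that `λ̂ = λ + 7/270` in (6.2)), and the `β⁻¹`-coefficient of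
`β'` in (3.7) at `λ = λ*` is `(5/4)λ* + 1/72 = −1/54 = −c₋₁`; the constant term is `−1/6 = −c₀`.
[cite: MullerSchiemann1987, §3 (3.7) p.267, §6 (6.2), (6.5) pp.278–279] -/
theorem consts_r2 :
    (1 / 4 : ℝ) * (-7 / 270) - 7 / 360 = -7 / 270 ∧ (5 / 4 : ℝ) * (-7 / 270) + 1 / 72 = -(1 / 54) ∧
      (1 / 72 : ℝ) - 5 / 3 * (7 / 360) = -(1 / 54) := by norm_num

/-- r = 4: `λ' = λ/16 − 7/160` (3.15) has the fixed point `λ* = −7/150`, and `(15/8)λ* + 1/48 = −1/15 = −c₋₁`;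
with `β̂ = β + 2λβ⁻¹ + O(β⁻¹)` (p. 278): `1/48 − 2·(7/160) = −1/15`; the constant term is `−1/2 = −c₀`.
[cite: MullerSchiemann1987, §3 (3.15) p.268, §6 (6.5) p.279, p.278 («β̂ = β + 2λβ⁻¹ + O(β⁻¹)»)] -/
theorem consts_r4 :
    (1 / 16 : ℝ) * (-7 / 150) - 7 / 160 = -7 / 150 ∧ (15 / 8 : ℝ) * (-7 / 150) + 1 / 48 = -(1 / 15) ∧
      (1 / 48 : ℝ) - 2 * (7 / 160) = -(1 / 15) := by norm_num

/-! ### §1. The comparison sequence `B_m` (6.6) -/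

/-- (6.6): `B_m := β₀ + c₀ m + (c₋₁/c₀) ln(1 + c₀ m/β₀)`. Here `c₁` stands for the printed `c₋₁`.
[cite: MullerSchiemann1987, §6 (6.6) p.279] -/
def B (c₀ c₁ β₀ : ℝ) (m : ℕ) : ℝ := β₀ + c₀ * m + c₁ / c₀ * Real.log (1 + c₀ * m / β₀)

variable {c₀ c₁ β₀ : ℝ}

/-- `B_0 = β₀`. [cite: MullerSchiemann1987, §6 (6.6) p.279] -/
theorem B_zero : B c₀ c₁ β₀ 0 = β₀ := by simp [B]

/-- The logarithm in (6.6) is nonnegative. [cite: MullerSchiemann1987, §6 (6.6) p.279] -/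
theorem log_term_nonneg (hc₀ : 0 < c₀) (hβ₀ : 0 < β₀) (m : ℕ) :
    0 ≤ Real.log (1 + c₀ * m / β₀) := by
  apply Real.log_nonneg
  have : 0 ≤ c₀ * m / β₀ := by positivity
  linarith

/-- (6.6) for `r = 2` ((6.5): `c₀ = 1/6`, `c₋₁ = 1/54`, so `c₋₁/c₀ = 1/9`):
`B_m = β₀ + m/6 + (1/9) ln(1 + m/(6β₀))`. [cite: MullerSchiemann1987, §6 (6.5)–(6.6) p.279] -/
theorem B_r2 (β₀ : ℝ) (m : ℕ) :
    B (1 / 6) (1 / 54) β₀ m = β₀ + m / 6 + 1 / 9 * Real.log (1 + m / (6 * β₀)) := by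
  have h : (1 : ℝ) + 1 / 6 * m / β₀ = 1 + m / (6 * β₀) := by ring
  rw [B, h]; ring

/-- (6.6) for the gauge block `r = 4` ((6.5): `c₀ = 1/2`, `c₋₁ = 1/15`, so `c₋₁/c₀ = 2/15`):
`B_m = β₀ + m/2 + (2/15) ln(1 + m/(2β₀))`. [cite: MullerSchiemann1987, §6 (6.5)–(6.6) p.279] -/
theorem B_r4 (β₀ : ℝ) (m : ℕ) :
    B (1 / 2) (1 / 15) β₀ m = β₀ + m / 2 + 2 / 15 * Real.log (1 + m / (2 * β₀)) := by
  have h : (1 : ℝ) + 1 / 2 * m / β₀ = 1 + m / (2 * β₀) := by ring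
  rw [B, h]; ring

/-- `β₀ + c₀ m ≤ B_m`. [cite: MullerSchiemann1987, §6 (6.6) p.279] -/
theorem lin_le_B (hc₀ : 0 < c₀) (hc₁ : 0 ≤ c₁) (hβ₀ : 0 < β₀) (m : ℕ) :
    β₀ + c₀ * m ≤ B c₀ c₁ β₀ m := by
  have h1 := log_term_nonneg hc₀ hβ₀ m
  have h2 : 0 ≤ c₁ / c₀ := div_nonneg hc₁ hc₀.le
  unfold B
  nlinarith

/-- `β₀ ≤ B_m`. [cite: MullerSchiemann1987, §6 (6.6) p.279] -/
theorem β₀_le_B (hc₀ : 0 < c₀) (hc₁ : 0 ≤ c₁) (hβ₀ : 0 < β₀) (m : ℕ) : β₀ ≤ B c₀ c₁ β₀ m := by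
  have := lin_le_B hc₀ hc₁ hβ₀ m
  have : 0 ≤ c₀ * m := by positivity
  linarith

/-- `0 < B_m`. [cite: MullerSchiemann1987, §6 (6.6) p.279] -/
theorem B_pos (hc₀ : 0 < c₀) (hc₁ : 0 ≤ c₁) (hβ₀ : 0 < β₀) (m : ℕ) : 0 < B c₀ c₁ β₀ m :=
  lt_of_lt_of_le hβ₀ (β₀_le_B hc₀ hc₁ hβ₀ m)

/-- `B_m ≤ (1 + c₋₁/(c₀β₀))(β₀ + c₀ m)` (from `ln(1+x) ≤ x`); this is the first factor of (6.12).
[cite: MullerSchiemann1987, §6 (6.12) p.280] -/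
theorem B_le_lin (hc₀ : 0 < c₀) (hc₁ : 0 ≤ c₁) (hβ₀ : 0 < β₀) (m : ℕ) :
    B c₀ c₁ β₀ m ≤ (1 + c₁ / (c₀ * β₀)) * (β₀ + c₀ * m) := by
  have hx : 0 < 1 + c₀ * m / β₀ := by positivity
  have hlog : Real.log (1 + c₀ * m / β₀) ≤ c₀ * m / β₀ := by
    have := Real.log_le_sub_one_of_pos hx
    linarith
  have h2 : 0 ≤ c₁ / c₀ := div_nonneg hc₁ hc₀.le
  have h3 : c₁ / c₀ * Real.log (1 + c₀ * m / β₀) ≤ c₁ / c₀ * (c₀ * m / β₀) :=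
    mul_le_mul_of_nonneg_left hlog h2
  have h4 : c₁ / c₀ * (c₀ * m / β₀) = c₁ * m / β₀ := by
    field_simp
  have h5 : c₁ * m / β₀ ≤ c₁ / (c₀ * β₀) * (β₀ + c₀ * m) := by
    rw [div_mul_eq_mul_div, div_le_div_iff₀ hβ₀ (by positivity)]
    have : 0 ≤ c₁ * β₀ * β₀ := by positivity
    nlinarith
  unfold B
  nlinarith

/-- Cruder form for `β₀ ≥ 1`: `B_m ≤ (1 + c₋₁/c₀)(β₀ + c₀ m)`. [cite: MullerSchiemann1987, §6 (6.12) p.280] -/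
theorem B_le_lin' (hc₀ : 0 < c₀) (hc₁ : 0 ≤ c₁) (hβ₀ : 1 ≤ β₀) (m : ℕ) :
    B c₀ c₁ β₀ m ≤ (1 + c₁ / c₀) * (β₀ + c₀ * m) := by
  have hβ₀' : 0 < β₀ := by linarith
  have h := B_le_lin hc₀ hc₁ hβ₀' m
  have h1 : c₁ / (c₀ * β₀) ≤ c₁ / c₀ := by
    rw [div_le_div_iff₀ (by positivity) hc₀]
    have : 0 ≤ c₁ * c₀ := by positivity
    nlinarith
  have h2 : 0 ≤ β₀ + c₀ * m := by positivity
  nlinarith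

/-- The increments of (6.6): `B_{m+1} − B_m = c₀ + (c₋₁/c₀) ln(1 + c₀/(β₀ + c₀ m))` (first line of
the computation behind (6.7)). [cite: MullerSchiemann1987, §6 (6.6)–(6.7) p.279] -/
theorem B_succ_sub (hc₀ : 0 < c₀) (hβ₀ : 0 < β₀) (m : ℕ) :
    B c₀ c₁ β₀ (m + 1) - B c₀ c₁ β₀ m = c₀ + c₁ / c₀ * Real.log (1 + c₀ / (β₀ + c₀ * m)) := by
  have hu : 0 < β₀ + c₀ * m := by positivity
  have hx1 : 0 < 1 + c₀ * ((m + 1 : ℕ) : ℝ) / β₀ := by positivity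
  have hx0 : 0 < 1 + c₀ * (m : ℝ) / β₀ := by positivity
  have hlog : Real.log (1 + c₀ * ((m + 1 : ℕ) : ℝ) / β₀) - Real.log (1 + c₀ * (m : ℝ) / β₀) =
      Real.log (1 + c₀ / (β₀ + c₀ * m)) := by
    rw [← Real.log_div hx1.ne' hx0.ne']
    congr 1
    push_cast
    field_simp
    ring
  unfold B
  push_cast at hlog ⊢
  linear_combination (c₁ / c₀) * hlog

/-- `B_m + c₀ ≤ B_{m+1}` («the marginal coefficient β̂ decreases with increasing lattice spacing»).
[cite: MullerSchiemann1987, §6 p.279 L.7–9] -/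
theorem B_succ_ge (hc₀ : 0 < c₀) (hc₁ : 0 ≤ c₁) (hβ₀ : 0 < β₀) (m : ℕ) :
    B c₀ c₁ β₀ m + c₀ ≤ B c₀ c₁ β₀ (m + 1) := by
  have h := B_succ_sub (c₁ := c₁) hc₀ hβ₀ m
  have hu : 0 < β₀ + c₀ * m := by positivity
  have hl : 0 ≤ Real.log (1 + c₀ / (β₀ + c₀ * m)) := by
    apply Real.log_nonneg
    have : 0 ≤ c₀ / (β₀ + c₀ * m) := by positivity
    linarith
  have : 0 ≤ c₁ / c₀ * Real.log (1 + c₀ / (β₀ + c₀ * m)) := mul_nonneg (div_nonneg hc₁ hc₀.le) hl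
  linarith

/-- `B` is monotone in the scale index. [cite: MullerSchiemann1987, §6 (6.6) p.279] -/
theorem B_mono (hc₀ : 0 < c₀) (hc₁ : 0 ≤ c₁) (hβ₀ : 0 < β₀) : Monotone (B c₀ c₁ β₀) := by
  apply monotone_nat_of_le_succ
  intro m
  have := B_succ_ge hc₀ hc₁ hβ₀ m
  linarith

/-- `B` is strictly monotone (`c₀ > 0`). [cite: MullerSchiemann1987, §6 (6.6) p.279] -/
theorem B_strictMono (hc₀ : 0 < c₀) (hc₁ : 0 ≤ c₁) (hβ₀ : 0 < β₀) : StrictMono (B c₀ c₁ β₀) := by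
  apply strictMono_nat_of_lt_succ
  intro m
  have := B_succ_ge hc₀ hc₁ hβ₀ m
  linarith

/-- (6.12) (non-strict form, all `n ≤ N`): `B_N ≤ B_n (1 + c₋₁/(c₀β₀)) (1 + c₀/β₀)^{N−n}`.
[cite: MullerSchiemann1987, §6 (6.12) p.280] -/
theorem B_le_geom (hc₀ : 0 < c₀) (hc₁ : 0 ≤ c₁) (hβ₀ : 0 < β₀) {n N : ℕ} (hnN : n ≤ N) :
    B c₀ c₁ β₀ N ≤ B c₀ c₁ β₀ n * (1 + c₁ / (c₀ * β₀)) * (1 + c₀ / β₀) ^ (N - n) := by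
  obtain ⟨j, rfl⟩ := Nat.exists_eq_add_of_le hnN
  rw [Nat.add_sub_cancel_left]
  have hlin : ∀ j : ℕ, β₀ + c₀ * ((n + j : ℕ) : ℝ) ≤ (β₀ + c₀ * n) * (1 + c₀ / β₀) ^ j := by
    intro j
    induction j with
    | zero => simp
    | succ j ih =>
      have hpos : 0 ≤ β₀ + c₀ * ((n + j : ℕ) : ℝ) := by positivity
      have hθ : 0 ≤ 1 + c₀ / β₀ := by positivity
      have step : β₀ + c₀ * ((n + (j + 1) : ℕ) : ℝ) ≤ (β₀ + c₀ * ((n + j : ℕ) : ℝ)) * (1 + c₀ / β₀) := by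
        have hβle : β₀ ≤ β₀ + c₀ * ((n + j : ℕ) : ℝ) := by
          have : 0 ≤ c₀ * ((n + j : ℕ) : ℝ) := by positivity
          linarith
        have key : c₀ ≤ (β₀ + c₀ * ((n + j : ℕ) : ℝ)) * (c₀ / β₀) := by
          rw [mul_div_assoc']
          rw [le_div_iff₀ hβ₀]
          nlinarith
        push_cast at key ⊢
        nlinarith
      calc β₀ + c₀ * ((n + (j + 1) : ℕ) : ℝ) ≤ (β₀ + c₀ * ((n + j : ℕ) : ℝ)) * (1 + c₀ / β₀) := step
        _ ≤ (β₀ + c₀ * n) * (1 + c₀ / β₀) ^ j * (1 + c₀ / β₀) :=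
          mul_le_mul_of_nonneg_right ih hθ
        _ = (β₀ + c₀ * n) * (1 + c₀ / β₀) ^ (j + 1) := by ring
  have h1 := B_le_lin hc₀ hc₁ hβ₀ (n + j)
  have h2 := hlin j
  have h3 := lin_le_B hc₀ hc₁ hβ₀ n
  have hK : 0 ≤ 1 + c₁ / (c₀ * β₀) := by positivity
  have hθj : 0 ≤ (1 + c₀ / β₀) ^ j := by positivity
  calc B c₀ c₁ β₀ (n + j) ≤ (1 + c₁ / (c₀ * β₀)) * (β₀ + c₀ * ((n + j : ℕ) : ℝ)) := h1
    _ ≤ (1 + c₁ / (c₀ * β₀)) * ((β₀ + c₀ * n) * (1 + c₀ / β₀) ^ j) :=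
      mul_le_mul_of_nonneg_left h2 hK
    _ ≤ (1 + c₁ / (c₀ * β₀)) * (B c₀ c₁ β₀ n * (1 + c₀ / β₀) ^ j) := by
      apply mul_le_mul_of_nonneg_left _ hK
      exact mul_le_mul_of_nonneg_right h3 hθj
    _ = B c₀ c₁ β₀ n * (1 + c₁ / (c₀ * β₀)) * (1 + c₀ / β₀) ^ j := by ring


/-! ### §2. The one-step comparison (6.7) -/

/-- The quantity `P` of (6.7), indexed by the LOWER scale: for `β̂ = B_{m+1} + d` the deviation of
`β̂ − c₀ − c₋₁β̂⁻¹` from `B_m + d`, i.e. `B_{m+1} + d − c₀ − c₋₁/(B_{m+1} + d) − B_m = d + P m d`.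
[cite: MullerSchiemann1987, §6 (6.7) p.279] -/
def P (c₀ c₁ β₀ : ℝ) (m : ℕ) (d : ℝ) : ℝ :=
  B c₀ c₁ β₀ (m + 1) + d - c₀ - c₁ / (B c₀ c₁ β₀ (m + 1) + d) - B c₀ c₁ β₀ m - d

/-- (6.7), the identity: `B_{m+1} + d − c₀ − c₋₁/(B_{m+1}+d) − B_m = d + P_m`.
[cite: MullerSchiemann1987, §6 (6.7) p.279] -/
theorem eq67 (m : ℕ) (d : ℝ) :
    B c₀ c₁ β₀ (m + 1) + d - c₀ - c₁ / (B c₀ c₁ β₀ (m + 1) + d) - B c₀ c₁ β₀ m = d + P c₀ c₁ β₀ m d := by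
  unfold P; ring

/-- `P_m(d) = (c₋₁/c₀) ln(1 + c₀/(β₀ + c₀m)) − c₋₁/(B_{m+1} + d)`. [cite: MullerSchiemann1987, §6 (6.7) p.279] -/
theorem P_eq (hc₀ : 0 < c₀) (hβ₀ : 0 < β₀) (m : ℕ) (d : ℝ) :
    P c₀ c₁ β₀ m d =
      c₁ / c₀ * Real.log (1 + c₀ / (β₀ + c₀ * m)) - c₁ / (B c₀ c₁ β₀ (m + 1) + d) := by
  have h := B_succ_sub (c₁ := c₁) hc₀ hβ₀ m
  unfold P
  linarith

/-- `(c₋₁/c₀) ln(1 + c₀/u) ≤ c₋₁/u` (`ln(1+x) ≤ x`): half of «one easily calculates» (6.7).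
[cite: MullerSchiemann1987, §6 (6.7) p.279] -/
theorem T1_le (hc₀ : 0 < c₀) (hc₁ : 0 ≤ c₁) {u : ℝ} (hu : 0 < u) :
    c₁ / c₀ * Real.log (1 + c₀ / u) ≤ c₁ / u := by
  have hx : 0 < 1 + c₀ / u := by positivity
  have hlog : Real.log (1 + c₀ / u) ≤ c₀ / u := by
    have := Real.log_le_sub_one_of_pos hx; linarith
  calc c₁ / c₀ * Real.log (1 + c₀ / u) ≤ c₁ / c₀ * (c₀ / u) :=
        mul_le_mul_of_nonneg_left hlog (div_nonneg hc₁ hc₀.le)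
    _ = c₁ / u := by field_simp

/-- `c₋₁/(u + c₀) ≤ (c₋₁/c₀) ln(1 + c₀/u)` (`ln y ≥ 1 − y⁻¹`): the other half of (6.7)'s computation.
[cite: MullerSchiemann1987, §6 (6.7) p.279] -/
theorem T1_ge (hc₀ : 0 < c₀) (hc₁ : 0 ≤ c₁) {u : ℝ} (hu : 0 < u) :
    c₁ / (u + c₀) ≤ c₁ / c₀ * Real.log (1 + c₀ / u) := by
  have hx : 0 < 1 + c₀ / u := by positivity
  have hlog : c₀ / (u + c₀) ≤ Real.log (1 + c₀ / u) := by
    have h := Real.one_sub_inv_le_log_of_pos hx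
    have e1 : (1 + c₀ / u)⁻¹ = u / (u + c₀) := by
      field_simp
    have e2 : 1 - u / (u + c₀) = c₀ / (u + c₀) := by
      field_simp
      ring
    rw [e1, e2] at h
    exact h
  calc c₁ / (u + c₀) = c₁ / c₀ * (c₀ / (u + c₀)) := by field_simp
    _ ≤ c₁ / c₀ * Real.log (1 + c₀ / u) := mul_le_mul_of_nonneg_left hlog (div_nonneg hc₁ hc₀.le)

/-- For `β₀ ≥ 1`: `B_{m+1} ≤ (β₀ + c₀m) + c₀ + (c₋₁/c₀) ln((β₀ + c₀m) + c₀)`.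
[cite: MullerSchiemann1987, §6 (6.6) p.279] -/
theorem B_succ_le_log (hc₀ : 0 < c₀) (hc₁ : 0 ≤ c₁) (hβ₀ : 1 ≤ β₀) (m : ℕ) :
    B c₀ c₁ β₀ (m + 1) ≤ β₀ + c₀ * m + c₀ + c₁ / c₀ * Real.log (β₀ + c₀ * m + c₀) := by
  have hβ₀' : 0 < β₀ := by linarith
  have hu : 0 < β₀ + c₀ * m + c₀ := by positivity
  have hx : 0 < 1 + c₀ * ((m + 1 : ℕ) : ℝ) / β₀ := by positivity
  have hle : 1 + c₀ * ((m + 1 : ℕ) : ℝ) / β₀ ≤ β₀ + c₀ * m + c₀ := by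
    have h1 : 1 + c₀ * ((m + 1 : ℕ) : ℝ) / β₀ = (β₀ + c₀ * m + c₀) / β₀ := by
      push_cast; field_simp; ring
    rw [h1, div_le_iff₀ hβ₀']
    nlinarith
  have hlog := Real.log_le_log hx hle
  have h2 : 0 ≤ c₁ / c₀ := div_nonneg hc₁ hc₀.le
  have h3 := mul_le_mul_of_nonneg_left hlog h2
  unfold B
  push_cast at h3 ⊢
  nlinarith

/-- The constant of (6.7) (with `ε₁ = ε`): `C₁ = 2c₋₁(1 + c₋₁/c₀)²((c₀ + S) + c₋₁(1 + c₀)/(c₀ε))`.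
[cite: MullerSchiemann1987, §6 (6.7) p.279] -/
def C₁ (c₀ c₁ S ε : ℝ) : ℝ := 2 * c₁ * (1 + c₁ / c₀) ^ 2 * ((c₀ + S) + c₁ * (1 + c₀) / (c₀ * ε))

/-- `0 ≤ C₁`. [cite: MullerSchiemann1987, §6 (6.7) p.279] -/
theorem C₁_nonneg (hc₀ : 0 < c₀) (hc₁ : 0 ≤ c₁) {S ε : ℝ} (hS : 0 ≤ S) (hε : 0 < ε) :
    0 ≤ C₁ c₀ c₁ S ε := by
  unfold C₁; positivity

/-- The core estimate behind (6.7): `|P_m(d)| ≤ 2c₋₁ w/u²` with `u = β₀ + c₀ m`,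
`w = c₀ + S + (c₋₁/c₀) ln(u + c₀)`, for `|d| ≤ S`, `β₀ ≥ max(1, 2S)`. [cite: MullerSchiemann1987, §6 (6.7) p.279] -/
theorem abs_P_le_aux (hc₀ : 0 < c₀) (hc₁ : 0 ≤ c₁) {S : ℝ} (hS : 0 ≤ S) (hβ₀ : 1 ≤ β₀)
    (hβS : 2 * S ≤ β₀) (m : ℕ) {d : ℝ} (hd : |d| ≤ S) :
    |P c₀ c₁ β₀ m d| ≤
      2 * c₁ * (c₀ + S + c₁ / c₀ * Real.log (β₀ + c₀ * m + c₀)) / (β₀ + c₀ * m) ^ 2 := by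
  have hβ₀' : 0 < β₀ := by linarith
  set u := β₀ + c₀ * m with hu_def
  have hum : 0 ≤ c₀ * (m : ℝ) := by positivity
  have hu1 : 1 ≤ u := by rw [hu_def]; linarith
  have hu : 0 < u := by linarith
  have huS : 2 * S ≤ u := by rw [hu_def]; linarith
  set V := B c₀ c₁ β₀ (m + 1) + d with hV_def
  have hd1 : -S ≤ d := (abs_le.mp hd).1
  have hd2 : d ≤ S := (abs_le.mp hd).2
  have hBlo : u + c₀ ≤ B c₀ c₁ β₀ (m + 1) := by
    have := lin_le_B hc₀ hc₁ hβ₀' (m + 1)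
    push_cast at this; rw [hu_def]; linarith
  set ℓ := c₁ / c₀ * Real.log (u + c₀) with hℓ_def
  have hℓ : 0 ≤ ℓ := by
    rw [hℓ_def]
    exact mul_nonneg (div_nonneg hc₁ hc₀.le) (Real.log_nonneg (by linarith))
  have hBhi : B c₀ c₁ β₀ (m + 1) ≤ u + c₀ + ℓ := by
    have := B_succ_le_log hc₀ hc₁ hβ₀ m
    rw [hℓ_def, hu_def]; linarith
  have hVlo : u + c₀ - S ≤ V := by rw [hV_def]; linarith
  have hVhi : V ≤ u + c₀ + ℓ + S := by rw [hV_def]; linarith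
  have hV2 : u ≤ 2 * V := by linarith
  have hV : 0 < V := by linarith
  set w := c₀ + S + ℓ with hw_def
  have hw : 0 ≤ w := by rw [hw_def]; positivity
  have hPeq : P c₀ c₁ β₀ m d = c₁ / c₀ * Real.log (1 + c₀ / u) - c₁ / V := by
    rw [P_eq hc₀ hβ₀']
  -- upper bound
  have hup : P c₀ c₁ β₀ m d ≤ 2 * c₁ * w / u ^ 2 := by
    have h1 : P c₀ c₁ β₀ m d ≤ c₁ / u - c₁ / V := by
      rw [hPeq]; linarith [T1_le hc₀ hc₁ hu]
    have h2 : c₁ / u - c₁ / V = c₁ * (V - u) / (u * V) := by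
      rw [div_sub_div _ _ hu.ne' hV.ne']; ring
    have h3 : c₁ * (V - u) / (u * V) ≤ 2 * c₁ * w / u ^ 2 := by
      rw [div_le_div_iff₀ (by positivity) (by positivity)]
      have hVu : V - u ≤ w := by rw [hw_def]; linarith
      have k1 : (V - u) * u ≤ w * u := mul_le_mul_of_nonneg_right hVu hu.le
      have k2 : w * u ≤ w * (2 * V) := mul_le_mul_of_nonneg_left hV2 hw
      have k3 : c₁ * ((V - u) * u) ≤ c₁ * (w * (2 * V)) :=
        mul_le_mul_of_nonneg_left (k1.trans k2) hc₁
      have k4 : c₁ * ((V - u) * u) * u ≤ c₁ * (w * (2 * V)) * u :=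
        mul_le_mul_of_nonneg_right k3 hu.le
      have e1 : c₁ * (V - u) * u ^ 2 = c₁ * ((V - u) * u) * u := by ring
      have e2 : 2 * c₁ * w * (u * V) = c₁ * (w * (2 * V)) * u := by ring
      rw [e1, e2]; exact k4
    linarith
  -- lower bound
  have hlow : -(2 * c₁ * w / u ^ 2) ≤ P c₀ c₁ β₀ m d := by
    have h1 : c₁ / (u + c₀) - c₁ / V ≤ P c₀ c₁ β₀ m d := by
      rw [hPeq]; linarith [T1_ge hc₀ hc₁ hu]
    have huc : 0 < u + c₀ := by linarith
    have h2 : c₁ / (u + c₀) - c₁ / V = c₁ * (V - u - c₀) / ((u + c₀) * V) := by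
      rw [div_sub_div _ _ huc.ne' hV.ne']; ring
    have h3 : -(2 * c₁ * w / u ^ 2) ≤ c₁ * (V - u - c₀) / ((u + c₀) * V) := by
      have hSw : S ≤ w := by rw [hw_def]; linarith
      have k1 : -(V - u - c₀) ≤ S := by linarith
      have k2 : u ^ 2 ≤ 2 * ((u + c₀) * V) := by
        have hle1 : u ≤ u + c₀ := by linarith
        have := mul_le_mul hle1 hV2 hu.le (by linarith)
        rw [sq]; linarith
      have k3 : -(c₁ * S) / ((u + c₀) * V) ≤ c₁ * (V - u - c₀) / ((u + c₀) * V) := by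
        apply div_le_div_of_nonneg_right _ (by positivity)
        have := mul_le_mul_of_nonneg_left k1 hc₁
        linarith
      have k4 : -(2 * c₁ * S / u ^ 2) ≤ -(c₁ * S) / ((u + c₀) * V) := by
        rw [neg_div, neg_le_neg_iff, div_le_div_iff₀ (by positivity) (by positivity)]
        have hcS : 0 ≤ c₁ * S := by positivity
        have := mul_le_mul_of_nonneg_left k2 hcS
        linarith
      have k5 : -(2 * c₁ * w / u ^ 2) ≤ -(2 * c₁ * S / u ^ 2) := by
        rw [neg_le_neg_iff]
        apply div_le_div_of_nonneg_right _ (by positivity)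
        have := mul_le_mul_of_nonneg_left hSw hc₁
        linarith
      linarith
    linarith
  rw [hw_def] at hup hlow
  exact abs_le.mpr ⟨hlow, hup⟩

/-- **(6.7)** with the `ln m` terms absorbed into the exponent (`ε₁ = ε ∈ (0,1]`): for `|d| ≤ S` and
`β₀ ≥ max(1, 2S)`, `|P_m(d)| ≤ C₁ · B_m^{−2+ε}`, `C₁ = C₁(c₀, c₋₁, S, ε)` independent of `m`, `β₀`, `d`.
[cite: MullerSchiemann1987, §6 (6.7) p.279] -/
theorem abs_P_le (hc₀ : 0 < c₀) (hc₁ : 0 ≤ c₁) {S ε : ℝ} (hS : 0 ≤ S) (hε : 0 < ε) (hε1 : ε ≤ 1)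
    (hβ₀ : 1 ≤ β₀) (hβS : 2 * S ≤ β₀) (m : ℕ) {d : ℝ} (hd : |d| ≤ S) :
    |P c₀ c₁ β₀ m d| ≤ C₁ c₀ c₁ S ε * B c₀ c₁ β₀ m ^ (-2 + ε) := by
  have hβ₀' : 0 < β₀ := by linarith
  have h0 := abs_P_le_aux hc₀ hc₁ hS hβ₀ hβS m hd
  set u := β₀ + c₀ * m with hu_def
  have hum : 0 ≤ c₀ * (m : ℝ) := by positivity
  have hu1 : 1 ≤ u := by rw [hu_def]; linarith
  have hu : 0 < u := by linarith
  set b := B c₀ c₁ β₀ m with hb_def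
  have hb1 : 1 ≤ b := le_trans hβ₀ (β₀_le_B hc₀ hc₁ hβ₀' m)
  have hb : 0 < b := by linarith
  have hub : u ≤ b := lin_le_B hc₀ hc₁ hβ₀' m
  set K₀ := 1 + c₁ / c₀ with hK₀_def
  have hK₀ : 1 ≤ K₀ := by rw [hK₀_def]; have := div_nonneg hc₁ hc₀.le; linarith
  have hbK : b ≤ K₀ * u := B_le_lin' hc₀ hc₁ hβ₀ m
  -- the log term
  have hlog : Real.log (u + c₀) ≤ (1 + c₀) * b ^ ε / ε := by
    have h1 : Real.log (u + c₀) ≤ (u + c₀) ^ ε / ε := Real.log_le_rpow_div (by linarith) hε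
    have h2 : (u + c₀) ^ ε ≤ ((1 + c₀) * b) ^ ε := by
      apply Real.rpow_le_rpow (by linarith) _ hε.le
      nlinarith
    have h3 : ((1 + c₀) * b) ^ ε = (1 + c₀) ^ ε * b ^ ε :=
      Real.mul_rpow (by linarith) hb.le
    have h4 : (1 + c₀) ^ ε ≤ 1 + c₀ := by
      have := Real.rpow_le_rpow_of_exponent_le (x := 1 + c₀) (by linarith) hε1
      rwa [Real.rpow_one] at this
    have h5 : (1 + c₀) ^ ε * b ^ ε ≤ (1 + c₀) * b ^ ε :=
      mul_le_mul_of_nonneg_right h4 (by positivity)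
    calc Real.log (u + c₀) ≤ (u + c₀) ^ ε / ε := h1
      _ ≤ ((1 + c₀) * b) ^ ε / ε := div_le_div_of_nonneg_right h2 hε.le
      _ = (1 + c₀) ^ ε * b ^ ε / ε := by rw [h3]
      _ ≤ (1 + c₀) * b ^ ε / ε := div_le_div_of_nonneg_right h5 hε.le
  have hbε : 1 ≤ b ^ ε := Real.one_le_rpow hb1 hε.le
  -- w ≤ W b^ε
  have hw : c₀ + S + c₁ / c₀ * Real.log (β₀ + c₀ * m + c₀) ≤
      ((c₀ + S) + c₁ * (1 + c₀) / (c₀ * ε)) * b ^ ε := by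
    have e1 : c₀ + S ≤ (c₀ + S) * b ^ ε :=
      le_mul_of_one_le_right (by positivity) hbε
    have e2 : c₁ / c₀ * Real.log (u + c₀) ≤ c₁ / c₀ * ((1 + c₀) * b ^ ε / ε) :=
      mul_le_mul_of_nonneg_left hlog (div_nonneg hc₁ hc₀.le)
    have e3 : c₁ / c₀ * ((1 + c₀) * b ^ ε / ε) = c₁ * (1 + c₀) / (c₀ * ε) * b ^ ε := by
      field_simp
    have e4 : β₀ + c₀ * m + c₀ = u + c₀ := by rw [hu_def]
    rw [e4, add_mul]
    linarith
  have hW : 0 ≤ (c₀ + S) + c₁ * (1 + c₀) / (c₀ * ε) := by positivity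
  -- 1/u² ≤ K₀²/b²
  have hu2 : 2 * c₁ * (c₀ + S + c₁ / c₀ * Real.log (β₀ + c₀ * m + c₀)) / u ^ 2 ≤
      2 * c₁ * (((c₀ + S) + c₁ * (1 + c₀) / (c₀ * ε)) * b ^ ε) * (K₀ ^ 2 / b ^ 2) := by
    rw [div_le_iff₀ (by positivity)]
    have hnum : 0 ≤ 2 * c₁ * (((c₀ + S) + c₁ * (1 + c₀) / (c₀ * ε)) * b ^ ε) := by positivity
    have hfrac : 1 ≤ K₀ ^ 2 / b ^ 2 * u ^ 2 := by
      rw [div_mul_eq_mul_div, le_div_iff₀ (by positivity)]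
      have h' : b * b ≤ (K₀ * u) * (K₀ * u) := mul_le_mul hbK hbK hb.le (by positivity)
      have e : K₀ ^ 2 * u ^ 2 = (K₀ * u) * (K₀ * u) := by ring
      rw [e, one_mul, sq]; exact h'
    have step1 : 2 * c₁ * (c₀ + S + c₁ / c₀ * Real.log (β₀ + c₀ * m + c₀)) ≤
        2 * c₁ * (((c₀ + S) + c₁ * (1 + c₀) / (c₀ * ε)) * b ^ ε) :=
      mul_le_mul_of_nonneg_left hw (by positivity)
    calc 2 * c₁ * (c₀ + S + c₁ / c₀ * Real.log (β₀ + c₀ * m + c₀))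
        ≤ 2 * c₁ * (((c₀ + S) + c₁ * (1 + c₀) / (c₀ * ε)) * b ^ ε) * 1 := by linarith
      _ ≤ 2 * c₁ * (((c₀ + S) + c₁ * (1 + c₀) / (c₀ * ε)) * b ^ ε) * (K₀ ^ 2 / b ^ 2 * u ^ 2) :=
          mul_le_mul_of_nonneg_left hfrac hnum
      _ = 2 * c₁ * (((c₀ + S) + c₁ * (1 + c₀) / (c₀ * ε)) * b ^ ε) * (K₀ ^ 2 / b ^ 2) * u ^ 2 := by
          ring
  have hpow : b ^ (-2 + ε) = b ^ ε / b ^ 2 := by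
    rw [Real.rpow_add hb, Real.rpow_neg hb.le, Real.rpow_two]
    field_simp
  calc |P c₀ c₁ β₀ m d| ≤ 2 * c₁ * (c₀ + S + c₁ / c₀ * Real.log (β₀ + c₀ * m + c₀)) / u ^ 2 := h0
    _ ≤ 2 * c₁ * (((c₀ + S) + c₁ * (1 + c₀) / (c₀ * ε)) * b ^ ε) * (K₀ ^ 2 / b ^ 2) := hu2
    _ = C₁ c₀ c₁ S ε * b ^ (-2 + ε) := by
        rw [hpow, hK₀_def, C₁]; ring

/-! ### §3. The tail sums of (6.9) («bound the sums … by corresponding integrals») -/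

/-- One telescoping step, from the convexity of `t ↦ t^{p+1}` (`p < −1`):
`(−p−1) c (y+c)^p ≤ y^{p+1} − (y+c)^{p+1}` for `y > 0`, `c > 0`. [folklore] -/
private theorem rpow_step {p c y : ℝ} (hp : p < -1) (hc : 0 < c) (hy : 0 < y) :
    (-p - 1) * c * (y + c) ^ p ≤ y ^ (p + 1) - (y + c) ^ (p + 1) := by
  have hD : Convex ℝ (Set.Icc y (y + c)) := convex_Icc _ _
  have hpos : ∀ t ∈ Set.Icc y (y + c), 0 < t := fun t ht => lt_of_lt_of_le hy ht.1
  have hderiv : ∀ t ∈ Set.Icc y (y + c), HasDerivAt (fun s : ℝ => s ^ (p + 1)) ((p + 1) * t ^ p) t := by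
    intro t ht
    have h := Real.hasDerivAt_rpow_const (p := p + 1) (Or.inl (hpos t ht).ne')
    simpa using h
  have hcont : ContinuousOn (fun s : ℝ => s ^ (p + 1)) (Set.Icc y (y + c)) :=
    fun t ht => (hderiv t ht).continuousAt.continuousWithinAt
  have hdiff : DifferentiableOn ℝ (fun s : ℝ => s ^ (p + 1)) (interior (Set.Icc y (y + c))) :=
    fun t ht => (hderiv t (interior_subset ht)).differentiableAt.differentiableWithinAt
  have hbound : ∀ t ∈ interior (Set.Icc y (y + c)),
      deriv (fun s : ℝ => s ^ (p + 1)) t ≤ (p + 1) * (y + c) ^ p := by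
    intro t ht
    have ht' := interior_subset ht
    rw [(hderiv t ht').deriv]
    have h1 : (y + c) ^ p ≤ t ^ p := Real.rpow_le_rpow_of_nonpos (hpos t ht') ht'.2 (by linarith)
    have h2 : p + 1 ≤ 0 := by linarith
    exact mul_le_mul_of_nonpos_left h1 h2
  have key := hD.image_sub_le_mul_sub_of_deriv_le hcont hdiff hbound y
    (Set.left_mem_Icc.mpr (by linarith)) (y + c) (Set.right_mem_Icc.mpr (by linarith)) (by linarith)
  have e : (p + 1) * (y + c) ^ p * (y + c - y) = -((-p - 1) * c * (y + c) ^ p) := by ring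
  rw [e] at key
  linarith

/-- Telescoped: `Σ_{m=n}^{M} (β₀ + c₀ m)^p ≤ (β₀ + c₀ n)^p + ((β₀ + c₀ n)^{p+1} − (β₀ + c₀ M)^{p+1})/((−p−1)c₀)`
(sum over `Ico n (M+1)`), for `p < −1`.
[cite: MullerSchiemann1987, §6 p.280 L.6–8 («bound the sums … by corresponding integrals»)] -/
theorem sum_lin_rpow_le_aux (hc₀ : 0 < c₀) (hβ₀ : 0 < β₀) {p : ℝ} (hp : p < -1) {n M : ℕ}
    (hnM : n ≤ M) :
    ∑ m ∈ Ico n (M + 1), (β₀ + c₀ * m) ^ p ≤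
      (β₀ + c₀ * n) ^ p + ((β₀ + c₀ * n) ^ (p + 1) - (β₀ + c₀ * M) ^ (p + 1)) / ((-p - 1) * c₀) := by
  induction M, hnM using Nat.le_induction with
  | base =>
    rw [Nat.Ico_succ_singleton, sum_singleton]
    simp
  | succ M hnM ih =>
    rw [sum_Ico_succ_top (by omega), Nat.cast_succ]
    have hk : 0 < (-p - 1) * c₀ := mul_pos (by linarith) hc₀
    have hy : 0 < β₀ + c₀ * M := by positivity
    have step := rpow_step hp hc₀ hy
    have e : β₀ + c₀ * ((M : ℝ) + 1) = β₀ + c₀ * M + c₀ := by ring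
    rw [e]
    have step' : (β₀ + c₀ * M + c₀) ^ p ≤
        ((β₀ + c₀ * M) ^ (p + 1) - (β₀ + c₀ * M + c₀) ^ (p + 1)) / ((-p - 1) * c₀) := by
      rw [le_div_iff₀ hk]; linarith
    have split : ((β₀ + c₀ * n) ^ (p + 1) - (β₀ + c₀ * M + c₀) ^ (p + 1)) / ((-p - 1) * c₀) =
        ((β₀ + c₀ * n) ^ (p + 1) - (β₀ + c₀ * M) ^ (p + 1)) / ((-p - 1) * c₀) +
        ((β₀ + c₀ * M) ^ (p + 1) - (β₀ + c₀ * M + c₀) ^ (p + 1)) / ((-p - 1) * c₀) := by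
      rw [← add_div]; ring_nf
    rw [split]
    linarith

/-- For `p < −1`, `β₀ ≥ 1`: `Σ_{m ∈ [n, M)} (β₀ + c₀ m)^p ≤ (1 + 1/((−p−1)c₀)) (β₀ + c₀ n)^{p+1}`.
[cite: MullerSchiemann1987, §6 p.280 L.6–8] -/
theorem sum_lin_rpow_le (hc₀ : 0 < c₀) (hβ₀ : 1 ≤ β₀) {p : ℝ} (hp : p < -1) {n M : ℕ} (hnM : n ≤ M) :
    ∑ m ∈ Ico n M, (β₀ + c₀ * m) ^ p ≤ (1 + 1 / ((-p - 1) * c₀)) * (β₀ + c₀ * n) ^ (p + 1) := by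
  have hβ₀' : 0 < β₀ := by linarith
  have hk : 0 < (-p - 1) * c₀ := mul_pos (by linarith) hc₀
  have hx1 : 1 ≤ β₀ + c₀ * n := by
    have : 0 ≤ c₀ * (n : ℝ) := by positivity
    linarith
  have hx : 0 < β₀ + c₀ * n := by linarith
  have hmono : (β₀ + c₀ * n) ^ p ≤ (β₀ + c₀ * n) ^ (p + 1) :=
    Real.rpow_le_rpow_of_exponent_le hx1 (by linarith)
  have hnn : 0 ≤ (β₀ + c₀ * n) ^ (p + 1) := by positivity
  rcases Nat.eq_or_lt_of_le hnM with h | h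
  · subst h
    rw [Ico_self, sum_empty]
    have : 0 ≤ 1 + 1 / ((-p - 1) * c₀) := by positivity
    positivity
  · obtain ⟨M', rfl⟩ : ∃ M', M = M' + 1 := ⟨M - 1, by omega⟩
    have hnM' : n ≤ M' := by omega
    have h1 := sum_lin_rpow_le_aux hc₀ hβ₀' hp hnM'
    have h2 : 0 ≤ (β₀ + c₀ * M') ^ (p + 1) := by positivity
    have h3 : ((β₀ + c₀ * n) ^ (p + 1) - (β₀ + c₀ * M') ^ (p + 1)) / ((-p - 1) * c₀) ≤
        (β₀ + c₀ * n) ^ (p + 1) / ((-p - 1) * c₀) :=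
      div_le_div_of_nonneg_right (by linarith) hk.le
    calc ∑ m ∈ Ico n (M' + 1), (β₀ + c₀ * m) ^ p
        ≤ (β₀ + c₀ * n) ^ p + ((β₀ + c₀ * n) ^ (p + 1) - (β₀ + c₀ * M') ^ (p + 1)) / ((-p - 1) * c₀) := h1
      _ ≤ (β₀ + c₀ * n) ^ (p + 1) + (β₀ + c₀ * n) ^ (p + 1) / ((-p - 1) * c₀) := by linarith
      _ = (1 + 1 / ((-p - 1) * c₀)) * (β₀ + c₀ * n) ^ (p + 1) := by ring

/-- The constant of the tail-sum bound in terms of `B`: `κ = (1 + 1/((−p−1)c₀))(1 + c₋₁/c₀)^{−(p+1)}`. [folklore] -/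
def κ (c₀ c₁ p : ℝ) : ℝ := (1 + 1 / ((-p - 1) * c₀)) * (1 + c₁ / c₀) ^ (-(p + 1))

/-- `0 ≤ κ`. [cite: MullerSchiemann1987, §6 p.280 L.6–8] -/
theorem κ_nonneg (hc₀ : 0 < c₀) (hc₁ : 0 ≤ c₁) {p : ℝ} (hp : p < -1) : 0 ≤ κ c₀ c₁ p := by
  unfold κ
  have : 0 < (-p - 1) * c₀ := mul_pos (by linarith) hc₀
  have : 0 ≤ c₁ / c₀ := div_nonneg hc₁ hc₀.le
  positivity

/-- **Tail sums along (6.6)**: for `p < −1` and `β₀ ≥ 1`,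
`Σ_{m ∈ [n, M)} B_m^p ≤ κ · B_n^{p+1}` uniformly in `M` (the «corresponding integrals» of p. 280).
[cite: MullerSchiemann1987, §6 p.280 L.6–8] -/
theorem sum_B_rpow_le (hc₀ : 0 < c₀) (hc₁ : 0 ≤ c₁) (hβ₀ : 1 ≤ β₀) {p : ℝ} (hp : p < -1) {n M : ℕ}
    (hnM : n ≤ M) :
    ∑ m ∈ Ico n M, B c₀ c₁ β₀ m ^ p ≤ κ c₀ c₁ p * B c₀ c₁ β₀ n ^ (p + 1) := by
  have hβ₀' : 0 < β₀ := by linarith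
  have h1 : ∑ m ∈ Ico n M, B c₀ c₁ β₀ m ^ p ≤ ∑ m ∈ Ico n M, (β₀ + c₀ * m) ^ p := by
    apply sum_le_sum
    intro m _
    exact Real.rpow_le_rpow_of_nonpos (by positivity) (lin_le_B hc₀ hc₁ hβ₀' m) (by linarith)
  have h2 := sum_lin_rpow_le hc₀ hβ₀ hp hnM
  set K₀ := 1 + c₁ / c₀ with hK₀_def
  have hK₀ : 1 ≤ K₀ := by rw [hK₀_def]; have := div_nonneg hc₁ hc₀.le; linarith
  have hK₀' : 0 < K₀ := by linarith
  have hb : 0 < B c₀ c₁ β₀ n := B_pos hc₀ hc₁ hβ₀' n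
  have hlin : B c₀ c₁ β₀ n / K₀ ≤ β₀ + c₀ * n := by
    rw [div_le_iff₀ hK₀']
    have := B_le_lin' hc₀ hc₁ hβ₀ n
    linarith
  have h3 : (β₀ + c₀ * n) ^ (p + 1) ≤ (B c₀ c₁ β₀ n / K₀) ^ (p + 1) :=
    Real.rpow_le_rpow_of_nonpos (by positivity) hlin (by linarith)
  have h4 : (B c₀ c₁ β₀ n / K₀) ^ (p + 1) = K₀ ^ (-(p + 1)) * B c₀ c₁ β₀ n ^ (p + 1) := by
    rw [Real.div_rpow hb.le hK₀'.le, Real.rpow_neg hK₀'.le]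
    field_simp
  have hA : 0 ≤ 1 + 1 / ((-p - 1) * c₀) := by
    have : 0 < (-p - 1) * c₀ := mul_pos (by linarith) hc₀
    positivity
  calc ∑ m ∈ Ico n M, B c₀ c₁ β₀ m ^ p ≤ ∑ m ∈ Ico n M, (β₀ + c₀ * m) ^ p := h1
    _ ≤ (1 + 1 / ((-p - 1) * c₀)) * (β₀ + c₀ * n) ^ (p + 1) := h2
    _ ≤ (1 + 1 / ((-p - 1) * c₀)) * (K₀ ^ (-(p + 1)) * B c₀ c₁ β₀ n ^ (p + 1)) :=
        mul_le_mul_of_nonneg_left (h3.trans h4.le) hA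
    _ = κ c₀ c₁ p * B c₀ c₁ β₀ n ^ (p + 1) := by rw [κ, hK₀_def]; ring

/-! ### §4. PROPOSITION 2 — the marginal coefficient at all scales, (6.8) first line, via (6.9) -/

/-- `A′ = 4A₁ + C₁(c₀, c₋₁, 1, 2α)`: the constant in `|φ_m| ≤ A′ B_m^{−2+2α}` of (6.9)
(the print's `(1 + δ₅)A₁`, here with the `P`-contribution of (6.7) kept explicit).
[cite: MullerSchiemann1987, §6 (6.9) p.279] -/
def Aprime (c₀ c₁ A₁ α : ℝ) : ℝ := 4 * A₁ + C₁ c₀ c₁ 1 (2 * α)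

/-- `0 ≤ A′`. [cite: MullerSchiemann1987, §6 (6.9) p.279] -/
theorem Aprime_nonneg (hc₀ : 0 < c₀) (hc₁ : 0 ≤ c₁) {A₁ α : ℝ} (hA : 0 ≤ A₁) (hα : 0 < α) :
    0 ≤ Aprime c₀ c₁ A₁ α := by
  unfold Aprime
  have := C₁_nonneg hc₀ hc₁ (S := 1) (ε := 2 * α) zero_le_one (by linarith)
  positivity

/-- Remainders transported to `B`: if `y/2 ≤ x` then `x^q ≤ 4 y^q` for `−2 ≤ q ≤ 0`. [folklore] -/
private theorem rpow_le_four_mul {q x y : ℝ} (hq0 : q ≤ 0) (hq2 : -2 ≤ q) (hy : 0 < y) (hxy : y / 2 ≤ x) :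
    x ^ q ≤ 4 * y ^ q := by
  have hy2 : 0 < y / 2 := by positivity
  have h1 : x ^ q ≤ (y / 2) ^ q := Real.rpow_le_rpow_of_nonpos hy2 hxy hq0
  have h2 : (y / 2) ^ q = y ^ q * (2:ℝ) ^ (-q) := by
    rw [Real.div_rpow hy.le (by norm_num), Real.rpow_neg (by norm_num)]
    field_simp
  have h3 : (2:ℝ) ^ (-q) ≤ 4 := by
    have := Real.rpow_le_rpow_of_exponent_le (x := 2) (by norm_num) (show -q ≤ 2 by linarith)
    have e : (2:ℝ) ^ (2:ℝ) = 4 := by rw [Real.rpow_two]; norm_num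
    linarith
  have h4 : 0 ≤ y ^ q := by positivity
  calc x ^ q ≤ y ^ q * (2:ℝ) ^ (-q) := h1.trans h2.le
    _ ≤ y ^ q * 4 := mul_le_mul_of_nonneg_left h3 h4
    _ = 4 * y ^ q := by ring

/-- If `x ≤ 2y`, `y > 0`, then `x^q ≤ 2 y^q` for `0 ≤ q ≤ 1` (and `x ≥ 0`). [folklore] -/
private theorem rpow_le_two_mul {q x y : ℝ} (hq0 : 0 ≤ q) (hq1 : q ≤ 1) (hx : 0 ≤ x) (hy : 0 < y)
    (hxy : x ≤ 2 * y) : x ^ q ≤ 2 * y ^ q := by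
  have h1 : x ^ q ≤ (2 * y) ^ q := Real.rpow_le_rpow hx hxy hq0
  have h2 : (2 * y) ^ q = (2:ℝ) ^ q * y ^ q := Real.mul_rpow (by norm_num) hy.le
  have h3 : (2:ℝ) ^ q ≤ 2 := by
    have := Real.rpow_le_rpow_of_exponent_le (x := 2) (by norm_num) hq1
    rwa [Real.rpow_one] at this
  have h4 : 0 ≤ y ^ q := by positivity
  calc x ^ q ≤ (2:ℝ) ^ q * y ^ q := h1.trans h2.le
    _ ≤ 2 * y ^ q := mul_le_mul_of_nonneg_right h3 h4

/-- **One step of (6.9)**: if `|β̂^{(−m−1)} − B_{m+1}| ≤ 1` and the decoupled recursion (6.4) holds at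
this step, then `φ_m := (β̂^{(−m)} − B_m) − (β̂^{(−m−1)} − B_{m+1}) = R₁ + P_m` has
`|φ_m| ≤ A′ B_m^{−2+2α}` (the print: `|φ_{m}| < (1 + δ₅)A₁ B_{m}^{−2+2α}`), for `β₀ ≥ 2`.
[cite: MullerSchiemann1987, §6 p.279 L.22–24 (proof of Prop. 2)] -/
theorem step_bound (hc₀ : 0 < c₀) (hc₁ : 0 ≤ c₁) {A₁ α : ℝ} (hα : 0 < α) (hα2 : α ≤ 1 / 2)
    (hA : 0 ≤ A₁) (hβ2 : 2 ≤ β₀) {x : ℕ → ℝ} (m : ℕ)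
    (hd : |x (m + 1) - B c₀ c₁ β₀ (m + 1)| ≤ 1)
    (hstep : |x m - (x (m + 1) - c₀ - c₁ / x (m + 1))| ≤ A₁ * x (m + 1) ^ (-2 + 2 * α)) :
    |(x m - B c₀ c₁ β₀ m) - (x (m + 1) - B c₀ c₁ β₀ (m + 1))| ≤
      Aprime c₀ c₁ A₁ α * B c₀ c₁ β₀ m ^ (-2 + 2 * α) := by
  have hβ₀ : 0 < β₀ := by linarith
  have hβ1 : 1 ≤ β₀ := by linarith
  set d := x (m + 1) - B c₀ c₁ β₀ (m + 1) with hd_def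
  have hx1 : x (m + 1) = B c₀ c₁ β₀ (m + 1) + d := by rw [hd_def]; ring
  have hid : x (m + 1) - c₀ - c₁ / x (m + 1) - B c₀ c₁ β₀ m = d + P c₀ c₁ β₀ m d := by
    rw [hx1]; exact eq67 m d
  have hdecomp : x m - B c₀ c₁ β₀ m - d =
      (x m - (x (m + 1) - c₀ - c₁ / x (m + 1))) + P c₀ c₁ β₀ m d := by
    linear_combination hid
  have hP : |P c₀ c₁ β₀ m d| ≤ C₁ c₀ c₁ 1 (2 * α) * B c₀ c₁ β₀ m ^ (-2 + 2 * α) :=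
    abs_P_le hc₀ hc₁ zero_le_one (by linarith) (by linarith) hβ1 (by linarith) m hd
  have hBm : 0 < B c₀ c₁ β₀ m := B_pos hc₀ hc₁ hβ₀ m
  have hR : A₁ * x (m + 1) ^ (-2 + 2 * α) ≤ 4 * A₁ * B c₀ c₁ β₀ m ^ (-2 + 2 * α) := by
    have hmono : B c₀ c₁ β₀ m ≤ B c₀ c₁ β₀ (m + 1) := B_mono hc₀ hc₁ hβ₀ (Nat.le_succ m)
    have hlo : B c₀ c₁ β₀ (m + 1) - 1 ≤ x (m + 1) := by
      have := (abs_le.mp hd).1; rw [hd_def] at this; linarith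
    have hhalf : B c₀ c₁ β₀ m / 2 ≤ x (m + 1) := by linarith [β₀_le_B hc₀ hc₁ hβ₀ m]
    have h4 := rpow_le_four_mul (q := -2 + 2 * α) (by linarith) (by linarith) hBm hhalf
    have := mul_le_mul_of_nonneg_left h4 hA
    linarith
  calc |x m - B c₀ c₁ β₀ m - d|
      = |(x m - (x (m + 1) - c₀ - c₁ / x (m + 1))) + P c₀ c₁ β₀ m d| := by rw [hdecomp]
    _ ≤ |x m - (x (m + 1) - c₀ - c₁ / x (m + 1))| + |P c₀ c₁ β₀ m d| := abs_add_le _ _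
    _ ≤ 4 * A₁ * B c₀ c₁ β₀ m ^ (-2 + 2 * α) + C₁ c₀ c₁ 1 (2 * α) * B c₀ c₁ β₀ m ^ (-2 + 2 * α) :=
        add_le_add (hstep.trans hR) hP
    _ = Aprime c₀ c₁ A₁ α * B c₀ c₁ β₀ m ^ (-2 + 2 * α) := by rw [Aprime]; ring

/-- **(6.9), the inductive core of Proposition 2.** Under the decoupled recursion (6.4) (first line, used
wherever `β̂ ≥ β̄`), started at `β̂^{(−N)} = B_N + b_N`, `|b_N| ≤ b B_N⁻¹`: for every scale `n ≤ N`,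
`|β̂^{(−n)} − B_n| ≤ |b_N| + A′ Σ_{m=n}^{N−1} B_m^{−2+2α}` — provided `β₀` is large in the four printed
senses made explicit as hypotheses (`β₀ ≥ 2`, `β₀ ≥ β̄ + 1`, `β₀ ≥ 2b`, `2A′κ β₀^{−1+2α} ≤ 1`: «an
appropriate bound S₁ … and a constant δ₅ can be chosen on account of a sufficiently large value of β₀»).
[cite: MullerSchiemann1987, §6 Prop. 2, (6.9) p.279] -/
theorem prop2_core (hc₀ : 0 < c₀) (hc₁ : 0 ≤ c₁) {A₁ α b βbar : ℝ} (hα : 0 < α) (hα2 : α < 1 / 2)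
    (hA : 0 ≤ A₁) (hβ2 : 2 ≤ β₀) (hβbar : βbar + 1 ≤ β₀) (hβb : 2 * b ≤ β₀)
    (hβA : 2 * (Aprime c₀ c₁ A₁ α * κ c₀ c₁ (-2 + 2 * α)) * β₀ ^ (-1 + 2 * α) ≤ 1)
    {N : ℕ} {x : ℕ → ℝ} (hinit : |x N - B c₀ c₁ β₀ N| ≤ b * (B c₀ c₁ β₀ N)⁻¹)
    (hrec : ∀ k, k < N → βbar ≤ x (k + 1) →
      |x k - (x (k + 1) - c₀ - c₁ / x (k + 1))| ≤ A₁ * x (k + 1) ^ (-2 + 2 * α)) :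
    ∀ n, n ≤ N → |x n - B c₀ c₁ β₀ n| ≤
      b * (B c₀ c₁ β₀ N)⁻¹ + Aprime c₀ c₁ A₁ α * ∑ m ∈ Ico n N, B c₀ c₁ β₀ m ^ (-2 + 2 * α) := by
  have hβ₀ : 0 < β₀ := by linarith
  have hβ1 : 1 ≤ β₀ := by linarith
  have hp : (-2 + 2 * α : ℝ) < -1 := by linarith
  have hA' := Aprime_nonneg hc₀ hc₁ hA hα
  have hκ := κ_nonneg hc₀ hc₁ hp
  have hBpos : ∀ m, 0 < B c₀ c₁ β₀ m := fun m => B_pos hc₀ hc₁ hβ₀ m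
  have hBge : ∀ m, β₀ ≤ B c₀ c₁ β₀ m := fun m => β₀_le_B hc₀ hc₁ hβ₀ m
  -- the a-priori smallness of the right-hand side: it is ≤ 1 at every scale
  have hsmall : ∀ n, n ≤ N →
      b * (B c₀ c₁ β₀ N)⁻¹ + Aprime c₀ c₁ A₁ α * ∑ m ∈ Ico n N, B c₀ c₁ β₀ m ^ (-2 + 2 * α) ≤ 1 := by
    intro n hn
    have h1 : b * (B c₀ c₁ β₀ N)⁻¹ ≤ 1 / 2 := by
      rw [← div_eq_mul_inv, div_le_iff₀ (hBpos N)]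
      linarith [hBge N]
    have h2 : ∑ m ∈ Ico n N, B c₀ c₁ β₀ m ^ (-2 + 2 * α) ≤
        κ c₀ c₁ (-2 + 2 * α) * B c₀ c₁ β₀ n ^ (-2 + 2 * α + 1) :=
      sum_B_rpow_le hc₀ hc₁ hβ1 hp hn
    have h3 : B c₀ c₁ β₀ n ^ (-2 + 2 * α + 1) ≤ β₀ ^ (-1 + 2 * α) := by
      rw [show (-2 + 2 * α + 1 : ℝ) = -1 + 2 * α by ring]
      exact Real.rpow_le_rpow_of_nonpos hβ₀ (hBge n) (by linarith)
    have h4 : Aprime c₀ c₁ A₁ α * ∑ m ∈ Ico n N, B c₀ c₁ β₀ m ^ (-2 + 2 * α) ≤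
        Aprime c₀ c₁ A₁ α * (κ c₀ c₁ (-2 + 2 * α) * β₀ ^ (-1 + 2 * α)) :=
      mul_le_mul_of_nonneg_left (h2.trans (mul_le_mul_of_nonneg_left h3 hκ)) hA'
    linarith
  -- downward induction on the scale
  suffices H : ∀ j n, n + j = N → |x n - B c₀ c₁ β₀ n| ≤
      b * (B c₀ c₁ β₀ N)⁻¹ + Aprime c₀ c₁ A₁ α * ∑ m ∈ Ico n N, B c₀ c₁ β₀ m ^ (-2 + 2 * α) by
    intro n hn
    exact H (N - n) n (by omega)
  intro j
  induction j with
  | zero =>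
    intro n hn
    simp only [add_zero] at hn
    subst hn
    rw [Ico_self, sum_empty, mul_zero, add_zero]
    exact hinit
  | succ j ih =>
    intro n hn
    have hn1 : n + 1 + j = N := by omega
    have hnN : n < N := by omega
    have IH := ih (n + 1) hn1
    have hd1 : |x (n + 1) - B c₀ c₁ β₀ (n + 1)| ≤ 1 := IH.trans (hsmall (n + 1) (by omega))
    have hxlo : B c₀ c₁ β₀ (n + 1) - 1 ≤ x (n + 1) := by
      have := (abs_le.mp hd1).1; linarith
    have hdom : βbar ≤ x (n + 1) := by linarith [hBge (n + 1)]
    have hφ := step_bound hc₀ hc₁ hα hα2.le hA hβ2 n hd1 (hrec n hnN hdom)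
    have htri : |x n - B c₀ c₁ β₀ n| ≤
        |(x n - B c₀ c₁ β₀ n) - (x (n + 1) - B c₀ c₁ β₀ (n + 1))| +
          |x (n + 1) - B c₀ c₁ β₀ (n + 1)| := by
      have := abs_add_le ((x n - B c₀ c₁ β₀ n) - (x (n + 1) - B c₀ c₁ β₀ (n + 1)))
        (x (n + 1) - B c₀ c₁ β₀ (n + 1))
      rwa [sub_add_cancel] at this
    have hsum : ∑ m ∈ Ico n N, B c₀ c₁ β₀ m ^ (-2 + 2 * α) =
        B c₀ c₁ β₀ n ^ (-2 + 2 * α) + ∑ m ∈ Ico (n + 1) N, B c₀ c₁ β₀ m ^ (-2 + 2 * α) :=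
      sum_eq_sum_Ico_succ_bot hnN _
    rw [hsum, mul_add]
    linarith [htri, hφ, IH]

/-- The constant of Proposition 2 (first line): `K = b + A′κ`. [cite: MullerSchiemann1987, §6 Prop. 2 (6.8) p.279] -/
def Kconst (c₀ c₁ A₁ α b : ℝ) : ℝ := b + Aprime c₀ c₁ A₁ α * κ c₀ c₁ (-2 + 2 * α)

/-- An explicit «sufficiently large β₀»:
`β⋆ = max(2, β̄ + 1, 2b, (2A′κ)^{1/(1−2α)})`. [cite: MullerSchiemann1987, §6 p.279] -/
def βstar (c₀ c₁ A₁ α b βbar : ℝ) : ℝ :=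
  max (max 2 (βbar + 1)) (max (2 * b)
    ((2 * (Aprime c₀ c₁ A₁ α * κ c₀ c₁ (-2 + 2 * α))) ^ (1 / (1 - 2 * α))))

/-- What `β₀ ≥ β⋆` buys: `β₀ ≥ 2`, `β₀ ≥ β̄ + 1`, `β₀ ≥ 2b`, `2A′κ β₀^{−1+2α} ≤ 1`.
[cite: MullerSchiemann1987, §6 p.279 («on account of a sufficiently large value of β₀»)] -/
theorem βstar_spec (hc₀ : 0 < c₀) (hc₁ : 0 ≤ c₁) {A₁ α b βbar : ℝ} (hα : 0 < α) (hα2 : α < 1 / 2)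
    (hA : 0 ≤ A₁) (hβ : βstar c₀ c₁ A₁ α b βbar ≤ β₀) :
    2 ≤ β₀ ∧ βbar + 1 ≤ β₀ ∧ 2 * b ≤ β₀ ∧
      2 * (Aprime c₀ c₁ A₁ α * κ c₀ c₁ (-2 + 2 * α)) * β₀ ^ (-1 + 2 * α) ≤ 1 := by
  unfold βstar at hβ
  simp only [max_le_iff] at hβ
  obtain ⟨⟨h2, hbar⟩, hb2, hQ⟩ := hβ
  refine ⟨h2, hbar, hb2, ?_⟩
  have hβ₀ : 0 < β₀ := by linarith
  set Q := 2 * (Aprime c₀ c₁ A₁ α * κ c₀ c₁ (-2 + 2 * α)) with hQ_def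
  have hQ0 : 0 ≤ Q := by
    rw [hQ_def]
    have := Aprime_nonneg hc₀ hc₁ hA hα
    have := κ_nonneg hc₀ hc₁ (p := -2 + 2 * α) (by linarith)
    positivity
  have hs : 0 < 1 - 2 * α := by linarith
  have h1 : Q ≤ β₀ ^ (1 - 2 * α) := by
    have h := Real.rpow_le_rpow (Real.rpow_nonneg hQ0 _) hQ hs.le
    rwa [← Real.rpow_mul hQ0, one_div, inv_mul_cancel₀ hs.ne', Real.rpow_one] at h
  have h2 : β₀ ^ (-1 + 2 * α) = (β₀ ^ (1 - 2 * α))⁻¹ := by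
    rw [← Real.rpow_neg hβ₀.le]; ring_nf
  rw [h2, ← div_eq_mul_inv, div_le_one (Real.rpow_pos_of_pos hβ₀ _)]
  exact h1

/-- **PROPOSITION 2, first line of (6.8)** (Müller–Schiemann, CMP 110 (1987) p. 279), model-free form:
for `β₀ ≥ β⋆` every sequence `β̂^{(−k)} = x k`, `k = N, …, 0`, obeying the decoupled recursion (6.4)
`β̂′ = β̂ − c₀ − c₋₁β̂⁻¹ + R₁`, `|R₁| ≤ A₁β̂^{−2+2α}` in the weak-coupling domain `β̂ ≥ β̄`, with initial
value `β̂^{(−N)} = B_N + b_N`, `|b_N| ≤ b B_N⁻¹`, satisfies `|β̂^{(−n)} − B_n| ≤ K B_n^{−1+2α}` for all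
`n ≤ N` — `K`, `β⋆` independent of `N` («for n ∈ ℕ₀ uniformly in N ≥ n») — and stays in the domain.
[cite: MullerSchiemann1987, §6 Proposition 2 (6.8) first line, p.279] -/
theorem prop2_marginal (hc₀ : 0 < c₀) (hc₁ : 0 ≤ c₁) {A₁ α b βbar : ℝ} (hα : 0 < α) (hα2 : α < 1 / 2)
    (hA : 0 ≤ A₁) (hb : 0 ≤ b) (hβ : βstar c₀ c₁ A₁ α b βbar ≤ β₀)
    {N : ℕ} {x : ℕ → ℝ} (hinit : |x N - B c₀ c₁ β₀ N| ≤ b * (B c₀ c₁ β₀ N)⁻¹)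
    (hrec : ∀ k, k < N → βbar ≤ x (k + 1) →
      |x k - (x (k + 1) - c₀ - c₁ / x (k + 1))| ≤ A₁ * x (k + 1) ^ (-2 + 2 * α)) :
    ∀ n, n ≤ N →
      |x n - B c₀ c₁ β₀ n| ≤ Kconst c₀ c₁ A₁ α b * B c₀ c₁ β₀ n ^ (-1 + 2 * α) ∧
      |x n - B c₀ c₁ β₀ n| ≤ 1 ∧ βbar ≤ x n := by
  obtain ⟨hβ2, hβbar, hβb, hβA⟩ := βstar_spec hc₀ hc₁ hα hα2 hA hβ
  have hβ₀ : 0 < β₀ := by linarith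
  have hβ1 : 1 ≤ β₀ := by linarith
  have hp : (-2 + 2 * α : ℝ) < -1 := by linarith
  have hA' := Aprime_nonneg hc₀ hc₁ hA hα
  have hκ := κ_nonneg hc₀ hc₁ hp
  have core := prop2_core hc₀ hc₁ hα hα2 hA hβ2 hβbar hβb hβA hinit hrec
  intro n hn
  have hcn := core n hn
  have hBn : 0 < B c₀ c₁ β₀ n := B_pos hc₀ hc₁ hβ₀ n
  have hBn1 : 1 ≤ B c₀ c₁ β₀ n := hβ1.trans (β₀_le_B hc₀ hc₁ hβ₀ n)
  have hBN : B c₀ c₁ β₀ n ≤ B c₀ c₁ β₀ N := B_mono hc₀ hc₁ hβ₀ hn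
  -- |b_N| ≤ b B_N⁻¹ ≤ b B_n⁻¹ ≤ b B_n^{−1+2α}
  have h1 : b * (B c₀ c₁ β₀ N)⁻¹ ≤ b * B c₀ c₁ β₀ n ^ (-1 + 2 * α) := by
    apply mul_le_mul_of_nonneg_left _ hb
    calc (B c₀ c₁ β₀ N)⁻¹ ≤ (B c₀ c₁ β₀ n)⁻¹ := inv_anti₀ hBn hBN
      _ = B c₀ c₁ β₀ n ^ (-1 : ℝ) := (Real.rpow_neg_one _).symm
      _ ≤ B c₀ c₁ β₀ n ^ (-1 + 2 * α) := Real.rpow_le_rpow_of_exponent_le hBn1 (by linarith)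
  have h2 : ∑ m ∈ Ico n N, B c₀ c₁ β₀ m ^ (-2 + 2 * α) ≤
      κ c₀ c₁ (-2 + 2 * α) * B c₀ c₁ β₀ n ^ (-1 + 2 * α) := by
    have := sum_B_rpow_le hc₀ hc₁ hβ1 hp hn
    rwa [show (-2 + 2 * α + 1 : ℝ) = -1 + 2 * α by ring] at this
  have hmain : |x n - B c₀ c₁ β₀ n| ≤ Kconst c₀ c₁ A₁ α b * B c₀ c₁ β₀ n ^ (-1 + 2 * α) := by
    have h3 := mul_le_mul_of_nonneg_left h2 hA'
    calc |x n - B c₀ c₁ β₀ n|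
        ≤ b * (B c₀ c₁ β₀ N)⁻¹ + Aprime c₀ c₁ A₁ α * ∑ m ∈ Ico n N, B c₀ c₁ β₀ m ^ (-2 + 2 * α) := hcn
      _ ≤ b * B c₀ c₁ β₀ n ^ (-1 + 2 * α) +
          Aprime c₀ c₁ A₁ α * (κ c₀ c₁ (-2 + 2 * α) * B c₀ c₁ β₀ n ^ (-1 + 2 * α)) := add_le_add h1 h3
      _ = Kconst c₀ c₁ A₁ α b * B c₀ c₁ β₀ n ^ (-1 + 2 * α) := by rw [Kconst]; ring
  -- smallness and the domain
  have hone : |x n - B c₀ c₁ β₀ n| ≤ 1 := by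
    have hs1 : b * (B c₀ c₁ β₀ N)⁻¹ ≤ 1 / 2 := by
      rw [← div_eq_mul_inv, div_le_iff₀ (B_pos hc₀ hc₁ hβ₀ N)]
      linarith [β₀_le_B hc₀ hc₁ hβ₀ N]
    have hs2 : B c₀ c₁ β₀ n ^ (-1 + 2 * α) ≤ β₀ ^ (-1 + 2 * α) :=
      Real.rpow_le_rpow_of_nonpos hβ₀ (β₀_le_B hc₀ hc₁ hβ₀ n) (by linarith)
    have hs3 : Aprime c₀ c₁ A₁ α * ∑ m ∈ Ico n N, B c₀ c₁ β₀ m ^ (-2 + 2 * α) ≤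
        Aprime c₀ c₁ A₁ α * (κ c₀ c₁ (-2 + 2 * α) * β₀ ^ (-1 + 2 * α)) :=
      mul_le_mul_of_nonneg_left (h2.trans (mul_le_mul_of_nonneg_left hs2 hκ)) hA'
    linarith
  refine ⟨hmain, hone, ?_⟩
  have := (abs_le.mp hone).1
  linarith [β₀_le_B hc₀ hc₁ hβ₀ n]

/-- The «uniformly in N ≥ n» packaging of Proposition 2's first line: there are `β⋆` and `K`, depending
only on `c₀, c₋₁, A₁, α, b, β̄`, such that for every `β₀ ≥ β⋆`, every cutoff `N` and every admissible
trajectory, `|β̂^{(−n)} − B_n| ≤ K B_n^{−1+2α}` for all scales `n ≤ N`.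
[cite: MullerSchiemann1987, §6 Proposition 2 (6.8) first line, p.279] -/
theorem prop2_marginal_uniform (hc₀ : 0 < c₀) (hc₁ : 0 ≤ c₁) {A₁ α b βbar : ℝ} (hα : 0 < α)
    (hα2 : α < 1 / 2) (hA : 0 ≤ A₁) (hb : 0 ≤ b) :
    ∃ βs K : ℝ, ∀ β₀, βs ≤ β₀ → ∀ (N : ℕ) (x : ℕ → ℝ),
      |x N - B c₀ c₁ β₀ N| ≤ b * (B c₀ c₁ β₀ N)⁻¹ →
      (∀ k, k < N → βbar ≤ x (k + 1) →
        |x k - (x (k + 1) - c₀ - c₁ / x (k + 1))| ≤ A₁ * x (k + 1) ^ (-2 + 2 * α)) →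
      ∀ n, n ≤ N → |x n - B c₀ c₁ β₀ n| ≤ K * B c₀ c₁ β₀ n ^ (-1 + 2 * α) ∧ βbar ≤ x n :=
  ⟨βstar c₀ c₁ A₁ α b βbar, Kconst c₀ c₁ A₁ α b, fun _ hβ _ _ hinit hrec n hn =>
    let h := prop2_marginal hc₀ hc₁ hα hα2 hA hb hβ hinit hrec n hn
    ⟨h.1, h.2.2⟩⟩

/-- PROPOSITION 2, first line, for the `d = 4` gauge block `r = 4` (`c₀ = ½`, `c₋₁ = 1/15`, (6.5)).
[cite: MullerSchiemann1987, §6 Proposition 2 (6.8), (6.5) p.279] -/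
theorem prop2_marginal_r4 {A₁ α b βbar : ℝ} (hα : 0 < α) (hα2 : α < 1 / 2) (hA : 0 ≤ A₁) (hb : 0 ≤ b)
    (hβ : βstar (1 / 2) (1 / 15) A₁ α b βbar ≤ β₀) {N : ℕ} {x : ℕ → ℝ}
    (hinit : |x N - B (1 / 2) (1 / 15) β₀ N| ≤ b * (B (1 / 2) (1 / 15) β₀ N)⁻¹)
    (hrec : ∀ k, k < N → βbar ≤ x (k + 1) →
      |x k - (x (k + 1) - 1 / 2 - (1 / 15) / x (k + 1))| ≤ A₁ * x (k + 1) ^ (-2 + 2 * α)) :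
    ∀ n, n ≤ N →
      |x n - B (1 / 2) (1 / 15) β₀ n| ≤ Kconst (1 / 2) (1 / 15) A₁ α b * B (1 / 2) (1 / 15) β₀ n ^ (-1 + 2 * α) ∧
      βbar ≤ x n :=
  fun n hn =>
    let h := prop2_marginal (c₀ := 1 / 2) (c₁ := 1 / 15) (by norm_num) (by norm_num) hα hα2 hA hb hβ hinit hrec n hn
    ⟨h.1, h.2.2⟩

/-! ### §5. The representation (6.9) -/

/-- (6.9), the telescoped identity: with `φ_m := (β̂^{(−m)} − B_m) − (β̂^{(−m−1)} − B_{m+1})`,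
`β̂^{(−n)} − B_n = b_N + Σ_{m=n}^{N−1} φ_m` (`b_N = β̂^{(−N)} − B_N`). [cite: MullerSchiemann1987, §6 (6.9) p.279] -/
theorem eq69 (x : ℕ → ℝ) {n N : ℕ} (hnN : n ≤ N) :
    x n - B c₀ c₁ β₀ n = (x N - B c₀ c₁ β₀ N) +
      ∑ m ∈ Ico n N, ((x m - B c₀ c₁ β₀ m) - (x (m + 1) - B c₀ c₁ β₀ (m + 1))) := by
  obtain ⟨j, rfl⟩ := Nat.exists_eq_add_of_le hnN
  induction j with
  | zero => simp
  | succ j ih =>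
    have h := ih (Nat.le_add_right n j)
    rw [← add_assoc, sum_Ico_succ_top (Nat.le_add_right n j), h]
    ring

/-- (6.9), the bounds `|φ_m| ≤ A′ B_m^{−2+2α}` (`n ≤ m < N`) along any admissible trajectory, under
the hypotheses of `prop2_marginal`. [cite: MullerSchiemann1987, §6 (6.9) p.279] -/
theorem eq69_bound (hc₀ : 0 < c₀) (hc₁ : 0 ≤ c₁) {A₁ α b βbar : ℝ} (hα : 0 < α) (hα2 : α < 1 / 2)
    (hA : 0 ≤ A₁) (hb : 0 ≤ b) (hβ : βstar c₀ c₁ A₁ α b βbar ≤ β₀)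
    {N : ℕ} {x : ℕ → ℝ} (hinit : |x N - B c₀ c₁ β₀ N| ≤ b * (B c₀ c₁ β₀ N)⁻¹)
    (hrec : ∀ k, k < N → βbar ≤ x (k + 1) →
      |x k - (x (k + 1) - c₀ - c₁ / x (k + 1))| ≤ A₁ * x (k + 1) ^ (-2 + 2 * α)) :
    ∀ m, m < N → |(x m - B c₀ c₁ β₀ m) - (x (m + 1) - B c₀ c₁ β₀ (m + 1))| ≤
      Aprime c₀ c₁ A₁ α * B c₀ c₁ β₀ m ^ (-2 + 2 * α) := by
  intro m hm
  obtain ⟨hβ2, -, -, -⟩ := βstar_spec hc₀ hc₁ hα hα2 hA hβ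
  have hnext := prop2_marginal hc₀ hc₁ hα hα2 hA hb hβ hinit hrec (m + 1) (by omega)
  exact step_bound hc₀ hc₁ hα hα2.le hA hβ2 m hnext.2.1 (hrec m hm hnext.2.2)

/-! ### §6. The contractive couplings: (6.8) second and third lines via (6.10)–(6.11); (6.12) -/

/-- Telescoping a linear contraction: `y_n − ρ^J y_{n+J} = Σ_{j<J} ρ^j (y_{n+j} − ρ y_{n+j+1})`
((6.10)/(6.11) with `ψ_{k} = y_{k−1} − ρ y_k`). [cite: MullerSchiemann1987, §6 (6.10)–(6.11) p.280] -/
theorem geom_telescope (y : ℕ → ℝ) (ρ : ℝ) (n J : ℕ) :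
    y n - ρ ^ J * y (n + J) = ∑ j ∈ range J, ρ ^ j * (y (n + j) - ρ * y (n + j + 1)) := by
  induction J with
  | zero => simp
  | succ J ih =>
    rw [sum_range_succ, ← ih, pow_succ]
    have : n + (J + 1) = n + J + 1 := by ring
    rw [this]
    ring

/-- **(6.8) second line, mechanism of (6.10)**: a coupling obeying `y_{k} = ρ y_{k+1} + ψ_{k+1}` with
`0 ≤ ρ < 1` and `|ψ_{k+1}| ≤ A B_{k+1}^q`, `q ≤ 0`, satisfies
`|y_n − ρ^{N−n} y_N| ≤ (A/(1−ρ)) B_n^q` for all `n ≤ N` (in print: `ρ = r^{−2}`, `q = −2+4α`).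
[cite: MullerSchiemann1987, §6 (6.8) second line via (6.10), pp.279–280] -/
theorem contractive_decay (hc₀ : 0 < c₀) (hc₁ : 0 ≤ c₁) (hβ₀ : 0 < β₀) {ρ q A : ℝ} (hρ0 : 0 ≤ ρ)
    (hρ1 : ρ < 1) (hq : q ≤ 0) (hA : 0 ≤ A) {N : ℕ} {y : ℕ → ℝ}
    (h : ∀ k, k < N → |y k - ρ * y (k + 1)| ≤ A * B c₀ c₁ β₀ (k + 1) ^ q) :
    ∀ n, n ≤ N → |y n - ρ ^ (N - n) * y N| ≤ A / (1 - ρ) * B c₀ c₁ β₀ n ^ q := by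
  intro n hn
  obtain ⟨J, rfl⟩ := Nat.exists_eq_add_of_le hn
  rw [Nat.add_sub_cancel_left, geom_telescope y ρ n J]
  have hBn : 0 < B c₀ c₁ β₀ n := B_pos hc₀ hc₁ hβ₀ n
  have hterm : ∀ j ∈ range J, |ρ ^ j * (y (n + j) - ρ * y (n + j + 1))| ≤
      ρ ^ j * (A * B c₀ c₁ β₀ n ^ q) := by
    intro j hj
    rw [abs_mul, abs_of_nonneg (pow_nonneg hρ0 j)]
    apply mul_le_mul_of_nonneg_left _ (pow_nonneg hρ0 j)
    have hjN : n + j < n + J := by simp at hj; omega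
    have h1 := h (n + j) hjN
    have hmono : B c₀ c₁ β₀ n ≤ B c₀ c₁ β₀ (n + j + 1) := B_mono hc₀ hc₁ hβ₀ (by omega)
    have h2 : B c₀ c₁ β₀ (n + j + 1) ^ q ≤ B c₀ c₁ β₀ n ^ q := Real.rpow_le_rpow_of_nonpos hBn hmono hq
    exact h1.trans (mul_le_mul_of_nonneg_left h2 hA)
  have hgeom : ∑ j ∈ range J, ρ ^ j ≤ 1 / (1 - ρ) := by
    have := geom_sum_Ico_le_of_lt_one (m := 0) (n := J) hρ0 hρ1
    rw [pow_zero] at this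
    rwa [range_eq_Ico]
  calc |∑ j ∈ range J, ρ ^ j * (y (n + j) - ρ * y (n + j + 1))|
      ≤ ∑ j ∈ range J, |ρ ^ j * (y (n + j) - ρ * y (n + j + 1))| := abs_sum_le_sum_abs _ _
    _ ≤ ∑ j ∈ range J, ρ ^ j * (A * B c₀ c₁ β₀ n ^ q) := sum_le_sum hterm
    _ = (∑ j ∈ range J, ρ ^ j) * (A * B c₀ c₁ β₀ n ^ q) := by rw [sum_mul]
    _ ≤ 1 / (1 - ρ) * (A * B c₀ c₁ β₀ n ^ q) :=
        mul_le_mul_of_nonneg_right hgeom (by positivity)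
    _ = A / (1 - ρ) * B c₀ c₁ β₀ n ^ q := by ring

/-- **(6.8) third line, mechanism of (6.11)** (growing remainders, `q ≥ 0`, «suitably chosen constants
δ₇», «1 + c₀/β₀ being small compared to r»): if `|ψ_{k+1}| ≤ A B_{k+1}^q` with `q ≥ 0` and the damping
condition `ρ(1 + c₀/β₀)^q < 1` holds, then `|y_n − ρ^{N−n} y_N| ≤ A((1 + c₋₁/(c₀β₀))(1 + c₀/β₀))^q/(1 −
ρ(1 + c₀/β₀)^q) · B_n^q` (in print: `ρ = r^{−4}`, `q = −2+6α`).
[cite: MullerSchiemann1987, §6 (6.8) third line via (6.11), pp.279–280] -/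
theorem contractive_growth (hc₀ : 0 < c₀) (hc₁ : 0 ≤ c₁) (hβ₀ : 0 < β₀) {ρ q A : ℝ} (hρ0 : 0 ≤ ρ)
    (hq : 0 ≤ q) (hA : 0 ≤ A) (hdamp : ρ * (1 + c₀ / β₀) ^ q < 1) {N : ℕ} {y : ℕ → ℝ}
    (h : ∀ k, k < N → |y k - ρ * y (k + 1)| ≤ A * B c₀ c₁ β₀ (k + 1) ^ q) :
    ∀ n, n ≤ N → |y n - ρ ^ (N - n) * y N| ≤
      A * ((1 + c₁ / (c₀ * β₀)) * (1 + c₀ / β₀)) ^ q / (1 - ρ * (1 + c₀ / β₀) ^ q) *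
        B c₀ c₁ β₀ n ^ q := by
  intro n hn
  obtain ⟨J, rfl⟩ := Nat.exists_eq_add_of_le hn
  rw [Nat.add_sub_cancel_left, geom_telescope y ρ n J]
  set K' := 1 + c₁ / (c₀ * β₀) with hK'
  set θ := 1 + c₀ / β₀ with hθ
  have hK'0 : 0 < K' := by rw [hK']; positivity
  have hθ0 : 0 < θ := by rw [hθ]; positivity
  have hθq : 0 < θ ^ q := Real.rpow_pos_of_pos hθ0 q
  have hBn : 0 < B c₀ c₁ β₀ n := B_pos hc₀ hc₁ hβ₀ n
  set τ := ρ * θ ^ q with hτ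
  have hτ0 : 0 ≤ τ := by rw [hτ]; positivity
  have hτ1 : τ < 1 := hdamp
  -- each term: ρ^j |ψ| ≤ A (K'θ)^q B_n^q τ^j
  have hterm : ∀ j ∈ range J, |ρ ^ j * (y (n + j) - ρ * y (n + j + 1))| ≤
      τ ^ j * (A * (K' * θ) ^ q * B c₀ c₁ β₀ n ^ q) := by
    intro j hj
    rw [abs_mul, abs_of_nonneg (pow_nonneg hρ0 j)]
    have hjN : n + j < n + J := by simp at hj; omega
    have h1 := h (n + j) hjN
    have hgeomB : B c₀ c₁ β₀ (n + j + 1) ≤ B c₀ c₁ β₀ n * K' * θ ^ (j + 1) := by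
      have := B_le_geom hc₀ hc₁ hβ₀ (n := n) (N := n + j + 1) (by omega)
      rwa [show n + j + 1 - n = j + 1 by omega] at this
    have h2 : B c₀ c₁ β₀ (n + j + 1) ^ q ≤ (B c₀ c₁ β₀ n * K' * θ ^ (j + 1)) ^ q :=
      Real.rpow_le_rpow (B_pos hc₀ hc₁ hβ₀ _).le hgeomB hq
    have h3 : (B c₀ c₁ β₀ n * K' * θ ^ (j + 1)) ^ q =
        B c₀ c₁ β₀ n ^ q * (K' * θ) ^ q * (θ ^ q) ^ j := by
      rw [Real.mul_rpow (by positivity) (by positivity), Real.mul_rpow hBn.le hK'0.le,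
        Real.mul_rpow hK'0.le hθ0.le, pow_succ, Real.mul_rpow (by positivity) hθ0.le,
        ← Real.rpow_natCast, ← Real.rpow_mul hθ0.le, mul_comm (j : ℝ) q, Real.rpow_mul hθ0.le,
        Real.rpow_natCast]
      ring
    have h4 : |y (n + j) - ρ * y (n + j + 1)| ≤ A * (B c₀ c₁ β₀ n ^ q * (K' * θ) ^ q * (θ ^ q) ^ j) :=
      h1.trans (by rw [← h3]; exact mul_le_mul_of_nonneg_left h2 hA)
    calc ρ ^ j * |y (n + j) - ρ * y (n + j + 1)|
        ≤ ρ ^ j * (A * (B c₀ c₁ β₀ n ^ q * (K' * θ) ^ q * (θ ^ q) ^ j)) :=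
          mul_le_mul_of_nonneg_left h4 (pow_nonneg hρ0 j)
      _ = τ ^ j * (A * (K' * θ) ^ q * B c₀ c₁ β₀ n ^ q) := by rw [hτ, mul_pow]; ring
  have hgeom : ∑ j ∈ range J, τ ^ j ≤ 1 / (1 - τ) := by
    have := geom_sum_Ico_le_of_lt_one (m := 0) (n := J) hτ0 hτ1
    rw [pow_zero] at this
    rwa [range_eq_Ico]
  have hC : 0 ≤ A * (K' * θ) ^ q * B c₀ c₁ β₀ n ^ q := by positivity
  calc |∑ j ∈ range J, ρ ^ j * (y (n + j) - ρ * y (n + j + 1))|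
      ≤ ∑ j ∈ range J, |ρ ^ j * (y (n + j) - ρ * y (n + j + 1))| := abs_sum_le_sum_abs _ _
    _ ≤ ∑ j ∈ range J, τ ^ j * (A * (K' * θ) ^ q * B c₀ c₁ β₀ n ^ q) := sum_le_sum hterm
    _ = (∑ j ∈ range J, τ ^ j) * (A * (K' * θ) ^ q * B c₀ c₁ β₀ n ^ q) := by rw [sum_mul]
    _ ≤ 1 / (1 - τ) * (A * (K' * θ) ^ q * B c₀ c₁ β₀ n ^ q) := mul_le_mul_of_nonneg_right hgeom hC
    _ = A * (K' * θ) ^ q / (1 - τ) * B c₀ c₁ β₀ n ^ q := by ring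

/-- **PROPOSITION 2, second line of (6.8)**, along the trajectory of `prop2_marginal`: if the second
coupling obeys (6.4) `λ̂′ = ρλ̂ + R₂`, `|R₂| ≤ A₂ β̂^{q}` (print: `ρ = r^{−2}`, `q = −2 + 4α ∈ [−2, 0]`) whenever
`β̂ ≥ β̄`, then `|λ̂^{(−n)} − ρ^{N−n} λ̂^{(−N)}| ≤ (4A₂/(1−ρ)) B_n^{q}` for all `n ≤ N`, `β₀ ≥ β⋆`.
[cite: MullerSchiemann1987, §6 Proposition 2 (6.8) second line, p.279] -/
theorem prop2_contractive (hc₀ : 0 < c₀) (hc₁ : 0 ≤ c₁) {A₁ α b βbar : ℝ} (hα : 0 < α)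
    (hα2 : α < 1 / 2) (hA : 0 ≤ A₁) (hb : 0 ≤ b) (hβ : βstar c₀ c₁ A₁ α b βbar ≤ β₀)
    {N : ℕ} {x : ℕ → ℝ} (hinit : |x N - B c₀ c₁ β₀ N| ≤ b * (B c₀ c₁ β₀ N)⁻¹)
    (hrec : ∀ k, k < N → βbar ≤ x (k + 1) →
      |x k - (x (k + 1) - c₀ - c₁ / x (k + 1))| ≤ A₁ * x (k + 1) ^ (-2 + 2 * α))
    {ρ q A₂ : ℝ} (hρ0 : 0 ≤ ρ) (hρ1 : ρ < 1) (hq0 : q ≤ 0) (hq2 : -2 ≤ q) (hA₂ : 0 ≤ A₂)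
    {y : ℕ → ℝ}
    (hrec2 : ∀ k, k < N → βbar ≤ x (k + 1) → |y k - ρ * y (k + 1)| ≤ A₂ * x (k + 1) ^ q) :
    ∀ n, n ≤ N → |y n - ρ ^ (N - n) * y N| ≤ 4 * A₂ / (1 - ρ) * B c₀ c₁ β₀ n ^ q := by
  obtain ⟨hβ2, -, -, -⟩ := βstar_spec hc₀ hc₁ hα hα2 hA hβ
  have hβ₀ : 0 < β₀ := by linarith
  have hmain := prop2_marginal hc₀ hc₁ hα hα2 hA hb hβ hinit hrec
  have h : ∀ k, k < N → |y k - ρ * y (k + 1)| ≤ 4 * A₂ * B c₀ c₁ β₀ (k + 1) ^ q := by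
    intro k hk
    have hk1 := hmain (k + 1) (by omega)
    have h1 := hrec2 k hk hk1.2.2
    have hlo : B c₀ c₁ β₀ (k + 1) - 1 ≤ x (k + 1) := by
      have := (abs_le.mp hk1.2.1).1; linarith
    have hhalf : B c₀ c₁ β₀ (k + 1) / 2 ≤ x (k + 1) := by linarith [β₀_le_B hc₀ hc₁ hβ₀ (k + 1)]
    have h2 := rpow_le_four_mul hq0 hq2 (B_pos hc₀ hc₁ hβ₀ (k + 1)) hhalf
    have := mul_le_mul_of_nonneg_left h2 hA₂
    linarith
  have := contractive_decay hc₀ hc₁ hβ₀ hρ0 hρ1 hq0 (by positivity : (0:ℝ) ≤ 4 * A₂) h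
  simpa [mul_div_assoc] using this

/-- **PROPOSITION 2, third line of (6.8)** (growing remainders), along the trajectory of
`prop2_marginal`: if `σ̂′ = ρσ̂ + R₃`, `|R₃| ≤ A₃ β̂^{q}` with `0 ≤ q ≤ 1` (print: `ρ = r^{−4}`, `q = −2 + 6α`,
`3/7 ≤ α < 1/2`) whenever `β̂ ≥ β̄`, and `ρ(1 + c₀/β₀)^q < 1`, then
`|σ̂^{(−n)} − ρ^{N−n} σ̂^{(−N)}| ≤ C · B_n^{q}` with `C` explicit and independent of `n`, `N`.
[cite: MullerSchiemann1987, §6 Proposition 2 (6.8) third line, p.279] -/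
theorem prop2_contractive_growth (hc₀ : 0 < c₀) (hc₁ : 0 ≤ c₁) {A₁ α b βbar : ℝ} (hα : 0 < α)
    (hα2 : α < 1 / 2) (hA : 0 ≤ A₁) (hb : 0 ≤ b) (hβ : βstar c₀ c₁ A₁ α b βbar ≤ β₀)
    {N : ℕ} {x : ℕ → ℝ} (hinit : |x N - B c₀ c₁ β₀ N| ≤ b * (B c₀ c₁ β₀ N)⁻¹)
    (hrec : ∀ k, k < N → βbar ≤ x (k + 1) →
      |x k - (x (k + 1) - c₀ - c₁ / x (k + 1))| ≤ A₁ * x (k + 1) ^ (-2 + 2 * α))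
    {ρ q A₃ : ℝ} (hρ0 : 0 ≤ ρ) (hq0 : 0 ≤ q) (hq1 : q ≤ 1) (hA₃ : 0 ≤ A₃)
    (hdamp : ρ * (1 + c₀ / β₀) ^ q < 1) {y : ℕ → ℝ}
    (hrec3 : ∀ k, k < N → βbar ≤ x (k + 1) → |y k - ρ * y (k + 1)| ≤ A₃ * x (k + 1) ^ q) :
    ∀ n, n ≤ N → |y n - ρ ^ (N - n) * y N| ≤
      2 * A₃ * ((1 + c₁ / (c₀ * β₀)) * (1 + c₀ / β₀)) ^ q / (1 - ρ * (1 + c₀ / β₀) ^ q) *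
        B c₀ c₁ β₀ n ^ q := by
  obtain ⟨hβ2, -, -, -⟩ := βstar_spec hc₀ hc₁ hα hα2 hA hβ
  have hβ₀ : 0 < β₀ := by linarith
  have hmain := prop2_marginal hc₀ hc₁ hα hα2 hA hb hβ hinit hrec
  have h : ∀ k, k < N → |y k - ρ * y (k + 1)| ≤ 2 * A₃ * B c₀ c₁ β₀ (k + 1) ^ q := by
    intro k hk
    have hk1 := hmain (k + 1) (by omega)
    have h1 := hrec3 k hk hk1.2.2
    have hBk := B_pos hc₀ hc₁ hβ₀ (k + 1)
    have hhi : x (k + 1) ≤ 2 * B c₀ c₁ β₀ (k + 1) := by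
      have := (abs_le.mp hk1.2.1).2; linarith [β₀_le_B hc₀ hc₁ hβ₀ (k + 1)]
    have hx0 : 0 ≤ x (k + 1) := by
      have := (abs_le.mp hk1.2.1).1; linarith [β₀_le_B hc₀ hc₁ hβ₀ (k + 1)]
    have h2 := rpow_le_two_mul hq0 hq1 hx0 hBk hhi
    have := mul_le_mul_of_nonneg_left h2 hA₃
    linarith
  have := contractive_growth hc₀ hc₁ hβ₀ hρ0 hq0 (by positivity : (0:ℝ) ≤ 2 * A₃) hdamp h
  simpa [mul_div_assoc, mul_assoc] using this

/-- (6.12)'s use (p. 280: «the first terms in (6.8) contributing to λ̂, σ̂ are strongly damped»):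
`ρ^{N−n} B_N ≤ (1 + c₋₁/(c₀β₀)) B_n (ρ(1 + c₀/β₀))^{N−n}`. [cite: MullerSchiemann1987, §6 (6.12) p.280] -/
theorem damping (hc₀ : 0 < c₀) (hc₁ : 0 ≤ c₁) (hβ₀ : 0 < β₀) {ρ : ℝ} (hρ0 : 0 ≤ ρ) {n N : ℕ}
    (hnN : n ≤ N) :
    ρ ^ (N - n) * B c₀ c₁ β₀ N ≤
      (1 + c₁ / (c₀ * β₀)) * B c₀ c₁ β₀ n * (ρ * (1 + c₀ / β₀)) ^ (N - n) := by
  have h := B_le_geom hc₀ hc₁ hβ₀ hnN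
  have hρ : 0 ≤ ρ ^ (N - n) := pow_nonneg hρ0 _
  calc ρ ^ (N - n) * B c₀ c₁ β₀ N
      ≤ ρ ^ (N - n) * (B c₀ c₁ β₀ n * (1 + c₁ / (c₀ * β₀)) * (1 + c₀ / β₀) ^ (N - n)) :=
        mul_le_mul_of_nonneg_left h hρ
    _ = (1 + c₁ / (c₀ * β₀)) * B c₀ c₁ β₀ n * (ρ * (1 + c₀ / β₀)) ^ (N - n) := by
        rw [mul_pow]; ring

/-! ### §7 (v1.1). The damping of the initial values, (6.13) and the `β`-line of (6.14) -/

/-- p.280: with the printed threshold `N > n + 2(ln r)⁻¹ln(β₀ + c₀n)` (here: `(β₀ + c₀n)² ≤ r^{N−n}`) and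
«`1 + c₀/β₀` being small compared to `r`» (here: `ρ(1 + c₀/β₀) ≤ r⁻¹`, `ρ` the contraction `r⁻²` or `r⁻⁴`),
an initial value `|y_N| ≤ C_y B_N` («`λ̂_N^{(−N)}` and `σ̂_N^{(−N)}` are restricted to be (at most) `O(β_N^{(−N)}) =
O(B_N)`») contributes at scale `n` at most `C_y(1 + c₋₁/(c₀β₀))³·B_n⁻¹`.
[cite: MullerSchiemann1987, §6 (6.12)–(6.13) p.280] -/
theorem damped_initial (hc₀ : 0 < c₀) (hc₁ : 0 ≤ c₁) (hβ₀ : 0 < β₀) {ρ r Cy yN : ℝ} (hρ : 0 ≤ ρ)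
    (hr : 0 < r) (hρθ : ρ * (1 + c₀ / β₀) ≤ r⁻¹) (hCy : 0 ≤ Cy) {n N : ℕ} (hnN : n ≤ N)
    (hthr : (β₀ + c₀ * n) ^ 2 ≤ r ^ (N - n)) (hy : |yN| ≤ Cy * B c₀ c₁ β₀ N) :
    ρ ^ (N - n) * |yN| ≤ Cy * (1 + c₁ / (c₀ * β₀)) ^ 3 * (B c₀ c₁ β₀ n)⁻¹ := by
  set K' := 1 + c₁ / (c₀ * β₀) with hK'
  have hK'0 : 0 ≤ c₁ / (c₀ * β₀) := by positivity
  have hK'1 : 1 ≤ K' := by rw [hK']; linarith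
  have hBn : 0 < B c₀ c₁ β₀ n := B_pos hc₀ hc₁ hβ₀ n
  have hu : 0 < β₀ + c₀ * n := by positivity
  have hρN : 0 ≤ ρ ^ (N - n) := pow_nonneg hρ _
  -- ρ^{N−n} B_N ≤ K' B_n (ρθ)^{N−n} ≤ K' B_n r^{−(N−n)}
  have h1 := damping hc₀ hc₁ hβ₀ hρ hnN
  have hρθ0 : 0 ≤ ρ * (1 + c₀ / β₀) := by positivity
  have h2 : (ρ * (1 + c₀ / β₀)) ^ (N - n) ≤ (r⁻¹) ^ (N - n) := pow_le_pow_left₀ hρθ0 hρθ _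
  have h3 : (r⁻¹) ^ (N - n) * (β₀ + c₀ * n) ^ 2 ≤ 1 := by
    rw [inv_pow]
    have hrN : 0 < r ^ (N - n) := pow_pos hr _
    rw [inv_mul_le_iff₀ hrN, mul_one]
    exact hthr
  -- (β₀ + c₀ n)⁻² ≤ K'²/B_n²
  have h4 : B c₀ c₁ β₀ n ≤ K' * (β₀ + c₀ * n) := B_le_lin hc₀ hc₁ hβ₀ n
  have h5 : ρ ^ (N - n) * B c₀ c₁ β₀ N ≤ K' * B c₀ c₁ β₀ n * (r⁻¹) ^ (N - n) := by
    calc ρ ^ (N - n) * B c₀ c₁ β₀ N ≤ K' * B c₀ c₁ β₀ n * (ρ * (1 + c₀ / β₀)) ^ (N - n) := h1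
      _ ≤ K' * B c₀ c₁ β₀ n * (r⁻¹) ^ (N - n) := mul_le_mul_of_nonneg_left h2 (by positivity)
  -- assemble
  have h6 : K' * B c₀ c₁ β₀ n * (r⁻¹) ^ (N - n) ≤ K' ^ 3 * (B c₀ c₁ β₀ n)⁻¹ := by
    -- multiply h3 by K' B_n / (β₀+c₀n)^2 and use (β₀+c₀n)^{-2} ≤ K'^2 B_n^{-2}
    have hrn : 0 ≤ (r⁻¹) ^ (N - n) := pow_nonneg (inv_nonneg.mpr hr.le) _
    have step1 : K' * B c₀ c₁ β₀ n * (r⁻¹) ^ (N - n) ≤ K' * B c₀ c₁ β₀ n * ((β₀ + c₀ * n) ^ 2)⁻¹ := by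
      apply mul_le_mul_of_nonneg_left _ (by positivity)
      have h3' : (r⁻¹) ^ (N - n) ≤ 1 / (β₀ + c₀ * n) ^ 2 := by
        rw [le_div_iff₀ (by positivity)]; exact h3
      simpa only [one_div] using h3'
    have step2 : ((β₀ + c₀ * n) ^ 2)⁻¹ ≤ K' ^ 2 * ((B c₀ c₁ β₀ n) ^ 2)⁻¹ := by
      rw [← div_eq_mul_inv, ← one_div, div_le_div_iff₀ (by positivity) (by positivity), one_mul]
      have := mul_le_mul h4 h4 hBn.le (by positivity)
      nlinarith
    calc K' * B c₀ c₁ β₀ n * (r⁻¹) ^ (N - n) ≤ K' * B c₀ c₁ β₀ n * ((β₀ + c₀ * n) ^ 2)⁻¹ := step1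
      _ ≤ K' * B c₀ c₁ β₀ n * (K' ^ 2 * ((B c₀ c₁ β₀ n) ^ 2)⁻¹) :=
          mul_le_mul_of_nonneg_left step2 (by positivity)
      _ = K' ^ 3 * (B c₀ c₁ β₀ n)⁻¹ := by field_simp
  calc ρ ^ (N - n) * |yN| ≤ ρ ^ (N - n) * (Cy * B c₀ c₁ β₀ N) := mul_le_mul_of_nonneg_left hy hρN
    _ = Cy * (ρ ^ (N - n) * B c₀ c₁ β₀ N) := by ring
    _ ≤ Cy * (K' * B c₀ c₁ β₀ n * (r⁻¹) ^ (N - n)) := mul_le_mul_of_nonneg_left h5 hCy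
    _ ≤ Cy * (K' ^ 3 * (B c₀ c₁ β₀ n)⁻¹) := mul_le_mul_of_nonneg_left h6 hCy
    _ = Cy * K' ^ 3 * (B c₀ c₁ β₀ n)⁻¹ := by ring

/-- **(6.13), the `λ̂`-line**: along the trajectory of `prop2_marginal`, if `λ̂′ = ρλ̂ + R₂`, `|R₂| ≤ A₂β̂^{q}`
(`ρ = r⁻²`, `q = −2+4α ∈ [−1, 0]`, i.e. `¼ ≤ α ≤ ½`), `|λ̂^{(−N)}| ≤ C_y B_N`, `ρ(1 + c₀/β₀) ≤ r⁻¹` and the cutoff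
is beyond the printed threshold, `(β₀ + c₀n)² ≤ r^{N−n}`, then `|λ̂^{(−n)}| ≤ C·B_n^{q}` with `C` explicit and
independent of `n`, `N`: «λ̂_N^{(−n)} = O(B_n^{−2+4α}) … uniformly in N > n + 2(ln r)⁻¹ln(β₀ + c₀n)».
[cite: MullerSchiemann1987, §6 (6.13) p.280] -/
theorem eq613 (hc₀ : 0 < c₀) (hc₁ : 0 ≤ c₁) {A₁ α b βbar : ℝ} (hα : 0 < α)
    (hα2 : α < 1 / 2) (hA : 0 ≤ A₁) (hb : 0 ≤ b) (hβ : βstar c₀ c₁ A₁ α b βbar ≤ β₀)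
    {N : ℕ} {x : ℕ → ℝ} (hinit : |x N - B c₀ c₁ β₀ N| ≤ b * (B c₀ c₁ β₀ N)⁻¹)
    (hrec : ∀ k, k < N → βbar ≤ x (k + 1) →
      |x k - (x (k + 1) - c₀ - c₁ / x (k + 1))| ≤ A₁ * x (k + 1) ^ (-2 + 2 * α))
    {ρ q A₂ r Cy : ℝ} (hρ0 : 0 ≤ ρ) (hρ1 : ρ < 1) (hq0 : q ≤ 0) (hq1 : -1 ≤ q) (hA₂ : 0 ≤ A₂)
    (hr : 0 < r) (hρθ : ρ * (1 + c₀ / β₀) ≤ r⁻¹) (hCy : 0 ≤ Cy)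
    {y : ℕ → ℝ} (hyN : |y N| ≤ Cy * B c₀ c₁ β₀ N)
    (hrec2 : ∀ k, k < N → βbar ≤ x (k + 1) → |y k - ρ * y (k + 1)| ≤ A₂ * x (k + 1) ^ q)
    {n : ℕ} (hn : n ≤ N) (hthr : (β₀ + c₀ * n) ^ 2 ≤ r ^ (N - n)) :
    |y n| ≤ (4 * A₂ / (1 - ρ) + Cy * (1 + c₁ / (c₀ * β₀)) ^ 3) * B c₀ c₁ β₀ n ^ q := by
  obtain ⟨hβ2, -, -, -⟩ := βstar_spec hc₀ hc₁ hα hα2 hA hβ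
  have hβ₀ : 0 < β₀ := by linarith
  have hBn : 0 < B c₀ c₁ β₀ n := B_pos hc₀ hc₁ hβ₀ n
  have hBn1 : 1 ≤ B c₀ c₁ β₀ n := le_trans (by linarith) (β₀_le_B hc₀ hc₁ hβ₀ n)
  have h1 := prop2_contractive hc₀ hc₁ hα hα2 hA hb hβ hinit hrec hρ0 hρ1 hq0 (by linarith) hA₂ hrec2 n hn
  have h2 := damped_initial hc₀ hc₁ hβ₀ hρ0 hr hρθ hCy hn hthr hyN
  have h3 : (B c₀ c₁ β₀ n)⁻¹ ≤ B c₀ c₁ β₀ n ^ q := by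
    rw [← Real.rpow_neg_one]
    exact Real.rpow_le_rpow_of_exponent_le hBn1 hq1
  have htri : |y n| ≤ |y n - ρ ^ (N - n) * y N| + ρ ^ (N - n) * |y N| := by
    have := abs_add_le (y n - ρ ^ (N - n) * y N) (ρ ^ (N - n) * y N)
    rw [sub_add_cancel, abs_mul, abs_of_nonneg (pow_nonneg hρ0 _)] at this
    exact this
  have h4 : Cy * (1 + c₁ / (c₀ * β₀)) ^ 3 * (B c₀ c₁ β₀ n)⁻¹ ≤
      Cy * (1 + c₁ / (c₀ * β₀)) ^ 3 * B c₀ c₁ β₀ n ^ q :=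
    mul_le_mul_of_nonneg_left h3 (by positivity)
  calc |y n| ≤ |y n - ρ ^ (N - n) * y N| + ρ ^ (N - n) * |y N| := htri
    _ ≤ 4 * A₂ / (1 - ρ) * B c₀ c₁ β₀ n ^ q + Cy * (1 + c₁ / (c₀ * β₀)) ^ 3 * B c₀ c₁ β₀ n ^ q :=
        add_le_add h1 (h2.trans h4)
    _ = (4 * A₂ / (1 - ρ) + Cy * (1 + c₁ / (c₀ * β₀)) ^ 3) * B c₀ c₁ β₀ n ^ q := by ring

/-- **(6.13), the `σ̂`-line** (growth case): along the trajectory of `prop2_marginal`, if `σ̂′ = ρσ̂ + R₃`,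
`|R₃| ≤ A₃β̂^{q}` with `0 ≤ q ≤ 1` (`ρ = r⁻⁴`, `q = −2+6α ∈ [4/7, 1)` for the printed `α`), the damping condition
`ρ(1 + c₀/β₀)^q < 1`, `|σ̂^{(−N)}| ≤ C_y B_N` («restricted to be (at most) O(β_N^{(−N)}) = O(B_N)»),
`ρ(1 + c₀/β₀) ≤ r⁻¹` and the cutoff beyond the printed threshold, `(β₀ + c₀n)² ≤ r^{N−n}`, then
`|σ̂^{(−n)}| ≤ C·B_n^{q}` with `C` explicit and independent of `n`, `N`: «σ̂_N^{(−n)} = O(B_n^{−2+6α})» (6.13).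
[cite: MullerSchiemann1987, §6 (6.13) p.280] -/
theorem eq613_sigma (hc₀ : 0 < c₀) (hc₁ : 0 ≤ c₁) {A₁ α b βbar : ℝ} (hα : 0 < α)
    (hα2 : α < 1 / 2) (hA : 0 ≤ A₁) (hb : 0 ≤ b) (hβ : βstar c₀ c₁ A₁ α b βbar ≤ β₀)
    {N : ℕ} {x : ℕ → ℝ} (hinit : |x N - B c₀ c₁ β₀ N| ≤ b * (B c₀ c₁ β₀ N)⁻¹)
    (hrec : ∀ k, k < N → βbar ≤ x (k + 1) →
      |x k - (x (k + 1) - c₀ - c₁ / x (k + 1))| ≤ A₁ * x (k + 1) ^ (-2 + 2 * α))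
    {ρ q A₃ r Cy : ℝ} (hρ0 : 0 ≤ ρ) (hq0 : 0 ≤ q) (hq1 : q ≤ 1) (hA₃ : 0 ≤ A₃)
    (hdamp : ρ * (1 + c₀ / β₀) ^ q < 1) (hr : 0 < r) (hρθ : ρ * (1 + c₀ / β₀) ≤ r⁻¹) (hCy : 0 ≤ Cy)
    {y : ℕ → ℝ} (hyN : |y N| ≤ Cy * B c₀ c₁ β₀ N)
    (hrec3 : ∀ k, k < N → βbar ≤ x (k + 1) → |y k - ρ * y (k + 1)| ≤ A₃ * x (k + 1) ^ q)
    {n : ℕ} (hn : n ≤ N) (hthr : (β₀ + c₀ * n) ^ 2 ≤ r ^ (N - n)) :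
    |y n| ≤ (2 * A₃ * ((1 + c₁ / (c₀ * β₀)) * (1 + c₀ / β₀)) ^ q / (1 - ρ * (1 + c₀ / β₀) ^ q) +
        Cy * (1 + c₁ / (c₀ * β₀)) ^ 3) * B c₀ c₁ β₀ n ^ q := by
  obtain ⟨hβ2, -, -, -⟩ := βstar_spec hc₀ hc₁ hα hα2 hA hβ
  have hβ₀ : 0 < β₀ := by linarith
  have hBn : 0 < B c₀ c₁ β₀ n := B_pos hc₀ hc₁ hβ₀ n
  have hBn1 : 1 ≤ B c₀ c₁ β₀ n := le_trans (by linarith) (β₀_le_B hc₀ hc₁ hβ₀ n)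
  have h1 := prop2_contractive_growth hc₀ hc₁ hα hα2 hA hb hβ hinit hrec hρ0 hq0 hq1 hA₃ hdamp
    hrec3 n hn
  have h2 := damped_initial hc₀ hc₁ hβ₀ hρ0 hr hρθ hCy hn hthr hyN
  have h3 : (B c₀ c₁ β₀ n)⁻¹ ≤ B c₀ c₁ β₀ n ^ q := by
    rw [← Real.rpow_neg_one]
    exact Real.rpow_le_rpow_of_exponent_le hBn1 (by linarith)
  have htri : |y n| ≤ |y n - ρ ^ (N - n) * y N| + ρ ^ (N - n) * |y N| := by
    have := abs_add_le (y n - ρ ^ (N - n) * y N) (ρ ^ (N - n) * y N)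
    rw [sub_add_cancel, abs_mul, abs_of_nonneg (pow_nonneg hρ0 _)] at this
    exact this
  have h4 : Cy * (1 + c₁ / (c₀ * β₀)) ^ 3 * (B c₀ c₁ β₀ n)⁻¹ ≤
      Cy * (1 + c₁ / (c₀ * β₀)) ^ 3 * B c₀ c₁ β₀ n ^ q :=
    mul_le_mul_of_nonneg_left h3 (by positivity)
  calc |y n| ≤ |y n - ρ ^ (N - n) * y N| + ρ ^ (N - n) * |y N| := htri
    _ ≤ 2 * A₃ * ((1 + c₁ / (c₀ * β₀)) * (1 + c₀ / β₀)) ^ q / (1 - ρ * (1 + c₀ / β₀) ^ q) *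
          B c₀ c₁ β₀ n ^ q + Cy * (1 + c₁ / (c₀ * β₀)) ^ 3 * B c₀ c₁ β₀ n ^ q :=
        add_le_add h1 (h2.trans h4)
    _ = (2 * A₃ * ((1 + c₁ / (c₀ * β₀)) * (1 + c₀ / β₀)) ^ q / (1 - ρ * (1 + c₀ / β₀) ^ q) +
        Cy * (1 + c₁ / (c₀ * β₀)) ^ 3) * B c₀ c₁ β₀ n ^ q := by ring

/-- **(6.14), the `β`-line, second step**: p.280, *«which entails due to (6.3), in the case of r = 2,
λ_N^{(−n)} = λ_* + O(B_n^{−2+4α}), λ_* = −7/270, σ_N^{(−n)} = O(B_n^{−2+6α}),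
β_N^{(−n)} = β̂_N^{(−n)} + O(B_n^{−1}) = B_n + O(B_n^{−1+2α}).  For r = 4 (6.14) holds with λ_* = −7/150.»*
(the two values of `λ_*` are the fixed points checked in `consts_r2`, `consts_r4`).  Model-free content of the
last equality: along the trajectory of `prop2_marginal`, ANY sequence `β` with `|β^{(−k)} − β̂^{(−k)}| ≤ C/β̂^{(−k)}`
(the inversion (6.3) of (6.2) with bounded `λ`, `σ` — a hypothesis here) satisfies
`|β^{(−n)} − B_n| ≤ (K + 2C)·B_n^{−1+2α}` for every `n ≤ N`, `K = Kconst` of `prop2_marginal`.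
[cite: MullerSchiemann1987, §6 (6.14) p.280] -/
theorem eq614_beta (hc₀ : 0 < c₀) (hc₁ : 0 ≤ c₁) {A₁ α b βbar : ℝ} (hα : 0 < α)
    (hα2 : α < 1 / 2) (hA : 0 ≤ A₁) (hb : 0 ≤ b) (hβ : βstar c₀ c₁ A₁ α b βbar ≤ β₀)
    {N : ℕ} {x : ℕ → ℝ} (hinit : |x N - B c₀ c₁ β₀ N| ≤ b * (B c₀ c₁ β₀ N)⁻¹)
    (hrec : ∀ k, k < N → βbar ≤ x (k + 1) →
      |x k - (x (k + 1) - c₀ - c₁ / x (k + 1))| ≤ A₁ * x (k + 1) ^ (-2 + 2 * α))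
    {C : ℝ} (hC : 0 ≤ C) {β : ℕ → ℝ} (hβx : ∀ k, k ≤ N → |β k - x k| ≤ C * (x k)⁻¹)
    {n : ℕ} (hn : n ≤ N) :
    |β n - B c₀ c₁ β₀ n| ≤ (Kconst c₀ c₁ A₁ α b + 2 * C) * B c₀ c₁ β₀ n ^ (-1 + 2 * α) := by
  obtain ⟨hβ2, -, -, -⟩ := βstar_spec hc₀ hc₁ hα hα2 hA hβ
  have hβ₀ : 0 < β₀ := by linarith
  have hBn2 : 2 ≤ B c₀ c₁ β₀ n := le_trans hβ2 (β₀_le_B hc₀ hc₁ hβ₀ n)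
  obtain ⟨hK, h1, -⟩ := prop2_marginal hc₀ hc₁ hα hα2 hA hb hβ hinit hrec n hn
  -- `x n ≥ B_n − 1 ≥ B_n/2`, so `(x n)⁻¹ ≤ 2 B_n⁻¹ ≤ 2 B_n^{−1+2α}`
  have hxlow : B c₀ c₁ β₀ n / 2 ≤ x n := by
    have := (abs_le.mp h1).1
    linarith
  have hxpos : 0 < x n := by linarith
  have h3 : (x n)⁻¹ ≤ 2 * B c₀ c₁ β₀ n ^ (-1 + 2 * α) := by
    have hinv : (x n)⁻¹ ≤ 2 * (B c₀ c₁ β₀ n)⁻¹ := by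
      rw [inv_le_comm₀ hxpos (by positivity)]
      calc (2 * (B c₀ c₁ β₀ n)⁻¹)⁻¹ = B c₀ c₁ β₀ n / 2 := by
            rw [mul_inv, inv_inv]; ring
        _ ≤ x n := hxlow
    have hpow : (B c₀ c₁ β₀ n)⁻¹ ≤ B c₀ c₁ β₀ n ^ (-1 + 2 * α) := by
      rw [← Real.rpow_neg_one]
      exact Real.rpow_le_rpow_of_exponent_le (by linarith) (by linarith)
    linarith
  calc |β n - B c₀ c₁ β₀ n| ≤ |β n - x n| + |x n - B c₀ c₁ β₀ n| := abs_sub_le _ _ _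
    _ ≤ C * (2 * B c₀ c₁ β₀ n ^ (-1 + 2 * α)) +
          Kconst c₀ c₁ A₁ α b * B c₀ c₁ β₀ n ^ (-1 + 2 * α) :=
        add_le_add ((hβx n hn).trans (mul_le_mul_of_nonneg_left h3 hC)) hK
    _ = (Kconst c₀ c₁ A₁ α b + 2 * C) * B c₀ c₁ β₀ n ^ (-1 + 2 * α) := by ring

end Literature.MathematicalPhysics.QuantumFieldTheory.MullerSchiemann1987.CouplingFlow

end
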